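import Summits.AnomalousDissipation.AnomalousDissipation.Theses.MomentParity
import Literature.Analysis.FluidPDE.StatisticalSolutionEnergyEq
import Literature.Analysis.FluidPDE.StatisticalSolutionDirac

/-!
# Disproof of `CubicParityLoud` — work file of the standing disprover (crux stmt-AnomalousDissipation-11465)

cdisprove seats `refuter-cdisprove-stmt-AnomalousDissipation-11465-0` (gen 1, §0–§10) and
`refuter-cdisprove-stmt-AnomalousDissipation-11465-g2-0` (gen 2, §11–: line `farkas-split-menu` picked), route `MomentParity` (rank-3 crux).
Everything below is `lean check`ed (rc 0, no `sorry`, axioms ⊆ {propext, Classical.choice, Quot.sound});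
§0–§9 are LANDED verbatim under `Theorems/CubicParityLoud/Negative/` (`--supports` the crux item):
`Clauses.lean` (§0,§1,§3; p73010) · `EnergyRow.lean` (§2; p74216) · `LoadBearing.lean` (§4–§5; p74454) ·
`Anatomy.lean` (§6–§7; p74647) · `MeanFlow.lean` (§8–§9; p75170) · `FluxFloor.lean` (§11; p85490, gen 2) — import
`Summits.AnomalousDissipation.AnomalousDissipation.Theorems.CubicParityLoud.Negative.MeanFlow` (+ `.FluxFloor`) for all of it
(namespace `Summit.AnomalousDissipation.AnomalousDissipation.Theorems.CubicParityLoud.Negative`).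

## Findings (gen 1 cycle 1 + gen 2 cycle 1; small-model numbers in §10: all-forms Casimir nullity = 2 and full stress span at
every level N = 2…6, job j008815; drefute kit j012825/j013392: EXACT momentum-graded nullity 2 / covariant nullity 0 at N = 2…9)

* **GEN 2 (line `farkas-split-menu` picked; drefute 0 false / 0 misstated on its 7 stubs).** Still NO KILL: with S1 (conic
  duality), S2 (cubic part of a certificate is a Casimir), S4 (menu kills Casimir certificates) TRUE and S5 (the menu)
  an explicit first/second-moment construction now largely landed, `CubicParityLoud ⟸ classification` (S3a + S3b beyond
  a threshold); conversely a disproof must exhibit, for one force, accidental quadratic Casimirs of the ball truncation at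
  INFINITELY MANY levels `N` that are one-signed on the menu — no trace of any accidental Casimir for `2 ≤ N ≤ 9`
  (all forms, exact arithmetic). New negative content: §11 FLUX FLOOR (third moments are charged: `∫Π_K dμ ≥ ε − o(1)`
  for `K_f ≲ K ≪ ν^{-1/2}`; no-go for sign-symmetric-fluctuation / low-mode-packet laws such as the S5 menu members
  themselves — the 3-stationary witness is necessarily produced by the duality, never by the menu).

* **NO KILL.** The crux as typed is an honest finite-dimensional order-3 moment-feasibility statement
  (junk audit clean: every Bochner/`toReal` junk value only hurts the `∃ μ` side; `Integrable ‖u‖³`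
  makes energy and all cubic rows honest; "level-`N`" erases `k = 0`). The only inputs a proof needs
  that are not in the tree are the two all-`N` algebra facts named by the planner (quadratic Casimirs of
  the ball-truncated Euler system `= span{E, H}`; the symmetric Reynolds-stress images `B_N(v,w)+B_N(w,v)`
  span the level-`N` solenoidal space) — neither is refutable by small models (N = 2: nullity 2, stress
  rank 64 = dim V₂, rattack evidence; NOW (§10, j008815): nullity 2 over ALL quadratic forms and full stress span at
  every level N = 2…6, up to 1848 real dims; the cone they generate is automatically a linear space because
  `Σ_a B_N(e_a,e_a) = 0` over any orthonormal basis — single Fourier modes are steady Euler flows).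
* **§2 ENERGY ROW (theorem `ensembleDissipation_eq_of_energyRow`).** For ANY law carried by level-`N`
  fields with `‖u‖` integrable, the single admissible quadratic test `p(u) = Σ_a (u,e_a)²` over the
  Galerkin frame (its differential is `2 P_N u = 2u`) forces
  `ensembleDissipation ν μ = ∫ (u, f) dμ = (f, ū)`: loudness IS injected power, carried entirely by the
  correlation of the MEAN FLOW with `f`. Corollaries: `ε ≤ ‖f‖₂ √E` (`IsWitness.le_power`),
  `(f, ū) ≥ ε` (`IsWitness.integral_pairing_ge`), no witness is symmetric under `u ↦ −u`
  (`IsWitness.map_neg_ne`: no centred Gaussian / Gibbs `exp(−βE−γH)` / `±`-atom law can witness).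
* **§1 BERNSTEIN CEILING (`ensembleDissipation_le_of_isLevel`, no stationarity used):**
  `ensembleDissipation ν μ ≤ 4π²N²ν · ensembleEnergy μ`, so a witness at level `N` needs
  `N² ≥ ε/(4π²νE)` (`IsWitness.le_bernstein`): the Taylor threshold `N₀(ν) ≳ ν^{-1/2}` is forced.
* **§4 LOAD-BEARING HYPOTHESES (all three refuted when dropped):** `f ≠ 0`
  (`cubicParityLoud_false_without_nonzero`, witness `f = 0`), `IsDivFree f`
  (`cubicParityLoud_false_without_divFree`, witness the gradient mode `cos(2πx₁)e₁`, invisible to `H`),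
  `HasZeroMean f` (`cubicParityLoud_false_without_zeroMean`, witness the constant wind `e₁`). In each
  case `(u, f) ≡ 0` on `H` and the energy row gives dissipation `0 < ε`. `IsSmooth f` is NOT load-bearing
  (only `P_N f` is ever seen) — information for the prover.
* **§8 MEAN-FLOW FLOOR:** the level-`N` mean flow `ū_N = Σ_a (∫(u,e_a)dμ) e_a` (itself an admissible test,
  `isBandTest_meanFlow`) does all the work: `(ū_N, g) = ∫(u,g)dμ` for band-limited `g` (`integral_inner_meanFlow`),
  hence `ε ≤ ‖f‖₂ ‖ū_N‖₂` (`IsWitness.le_meanFlow`) — every witness carries a MACROSCOPIC MEAN FLOW; no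
  zero-mean / isotropic / `u ↦ −u`-symmetric statistics can witness, whatever the fluctuations do.
* **§7 MOMENTUM FLOOR (new necessary condition, ε-independent):** the degree-1 rows alone give
  `(f, g) ≤ ν‖Δg‖₂√E + ‖∇g‖_∞ E` for every level-`N` band test `g` (`IsWitness.force_pairing_le`); with
  `g = P_N f`: `E ≥ (‖f‖₂² − o(1))/sup|∇f|` — ANY 2-stationary level-`N` statistics held against `f` at small `ν`
  is macroscopic; the Reynolds stresses must balance `f` (so "quiet small" and "loud small" laws are both out).
* **§5/§9 TIGHTNESS (refuted strengthenings):** `N₀` chosen before `ν` (`not_cubicParityLoudUniformLevel`,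
  Bernstein on the shear force `cos(2πx₁)e₂`); `(E, ε, ν₀)` uniform in the force
  (`not_cubicParityLoudUniformInForce`, scaling `f ↦ δf`, `ε ≤ δ‖f‖₂√E`); no viscosity threshold
  (`not_cubicParityLoudAllViscosities`, laminar ceiling `ε ≤ ‖f‖₂²/(4π²ν)`: witnesses need `ν ≤ ‖f‖₂²/(4π²ε)`).
  Together with `ε ≤ ‖f‖₂√E` and the momentum floor, every quantifier/constant of the crux is pinned to its scale.

## Why it resists (for ideators / the lead)

Order-3 stationarity constrains only `(m, C, T)` = moments of order ≤ 3. With `C ≻ 0` on `V_N` the third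
moment `T` is free (Fialkow–Nie Thm 1.3, vendored twice: `Literature.MeasureTheory.Moments.FialkowNie2010_thm13`
/ `…_thm_1_3`; or Gaussian ⊕ far sparse atoms), so the quadratic rows are solvable iff their right-hand side
is orthogonal to the quadratic Casimirs of `B_N`; the surviving constraints on `(m, C)` are: linear rows
`P_N f = νA m + B_N(m,m) + B_N(C)` (a `dim V_N`-dimensional linear condition on `C`, solvable in the PSD cone
as soon as the symmetric stress images span — cost `≲ Σ_q |ŵ(q)|/|q|`, uniform in `N`), the energy row
`ν(‖∇m‖² + tr ΛC) = (f, m)` (one scalar, fixes the amplitude of a `B_N`-invisible single-mode sea at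
`|k| ≈ (ε/νE)^{1/2} ≤ N`), the helicity row (one scalar of either sign: chirality of the sea), plus one scalar
per accidental Casimir. A disproof therefore needs, at infinitely many levels `N`, an EXTRA quadratic Casimir
whose `Λ`-weighted form is coercive on high shells (the 2-D enstrophy mechanism of `PlanarCubicQuiet`) or a
defect of the stress span — there is no small-model evidence for either (levels 2–4 and the 26/728-mode
cubes say `span{E,H}` exactly), and the per-triad helical analysis gives exactly `{E, H}` on every single
triad, so an accidental Casimir would have to solve a hugely over-determined homogeneous system.
What the NEGATIVE side pins down for any construction: mean flow with `(f, ū) = ε` exactly (§2), support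
reaching the Taylor shell (§1), asymmetry under `u ↦ −u` (§5), `ε ≤ ‖f‖₂√E`.

## Contents
§0 vocabulary (`IsLevel`, `IsBandTest`, `polyGrad`, `IsStationary3`, `IsWitness`, `cubicParityLoud_iff`)
· §1 Bernstein ceiling · §2 energy row + power ceiling · §3 concrete forces (zero, wind, gradient, shear)
· §4 `_false_without_` lemmas · §5 tightness / refuted strengthenings / symmetry obstruction
· §6 anatomy of a witness (energy floor, average-speed floor `‖f‖₂∫‖u‖ ≥ ε`, Taylor-shell charge `ν∫tail_m ≥ ε − 4π²m²νE`)
· §7 MOMENTUM FLOOR from the linear rows: `(f,g) ≤ ν‖Δg‖₂√E + ‖∇g‖_∞E` for band tests `g`; with `g = P_N f`, `E ≥ (‖f‖₂² − o(1))/sup|∇f|` independently of `ε`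
· §8 the level-`N` MEAN FLOW `ū_N` (an admissible test itself): `(ū_N, g) = ∫(u,g)dμ` for band-limited `g`, and the MEAN-FLOW FLOOR `ε ≤ ‖f‖₂‖ū_N‖₂`
· §9 LAMINAR CEILING `ε ≤ ‖f‖₂²/(4π²ν)` (Poincaré in the mean); refuted strengthening `CubicParityLoudAllViscosities` (no `ν₀`)
· §10 small-model numbers (j008815): all-forms quadratic Casimir nullity = 2 (= E, H) and full stress span at levels 2–6.
· §11 FLUX FLOOR (gen 2): `∫Π_K dμ = ∫(u,P_K f) − ν∫‖∇P_K u‖² ≥ ε − ‖f−P_K f‖₂√E − 4π²K²νE` for witnesses, `K ≤ N`.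
No `-- Targets` (line `farkas-split-menu` picked 2026-08-16T04:01Z; `stuck_stubs = []`; drefute: all 7 stubs survive).
-/

noncomputable section

namespace Summit.AnomalousDissipation.AnomalousDissipation.Cruxes.CubicParityLoud.Disproof

open MeasureTheory Filter UnitAddTorus
open scoped InnerProductSpace RealInnerProductSpace ENNReal
open Literature.Analysis.FunctionSpaces Literature.Analysis.FluidPDE
open Summit.AnomalousDissipation.AnomalousDissipation.Theses.MomentParity

set_option linter.dupNamespace false

/-- The 3-torus. -/
abbrev T3 : Type := UnitAddTorus (Fin 3)
/-- Velocity values. -/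
abbrev R3 : Type := EuclideanSpace ℝ (Fin 3)
/-- The energy space `H = L²_σ(T3)` of the crux. -/
abbrev H3 : Type := ↥(Torus.energySpace (Fin 3))
/-- `L²(T3; ℝ³)`. -/
abbrev L2T3 : Type := ↥(Lp (EuclideanSpace ℝ (Fin 3)) 2 (volume : Measure (UnitAddTorus (Fin 3))))

/-! ## §0 Vocabulary: the clauses of the crux, named (verbatim sub-terms of `CubicParityLoud`) -/

/-- `u ∈ H` is carried by the level-`N` Fourier–Galerkin space: `û(k) = 0` off `0 < |k|² ≤ N²`. -/
def IsLevel (N : ℕ) (u : H3) : Prop :=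
  ∀ k ∉ (Torus.freqBall N).erase (0 : Fin 3 → ℤ),
    mFourierCoeff (EuclideanSpace.complexify ∘ (u.1 : T3 → R3)) k = 0

/-- Band-limited smooth solenoidal mean-zero test field (the `g i` of the crux). -/
def IsBandTest (N : ℕ) (g : T3 → R3) : Prop :=
  Torus.IsSmooth g ∧ Torus.IsDivFree g ∧ Torus.HasZeroMean g ∧
    ∀ k ∉ (Torus.freqBall N).erase (0 : Fin 3 → ℤ), mFourierCoeff (EuclideanSpace.complexify ∘ g) k = 0

/-- The differential `∇p(u) = Σᵢ ∂ᵢP((u,g₁),…,(u,gₘ)) gᵢ` of a polynomial cylindrical observable. -/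
def polyGrad {m : ℕ} (g : Fin m → T3 → R3) (P : MvPolynomial (Fin m) ℝ) (u : H3) : T3 → R3 :=
  fun x => ∑ i : Fin m,
    (MvPolynomial.eval (fun j => Torus.pairing u.1 (g j)) (MvPolynomial.pderiv i P)) • g i x

/-- The 3-stationarity rows of the crux at `(ν, f, N)`: every polynomial cylindrical observable of
total degree `≤ 2` with level-`N` test fields is drift-free (integrable row, zero mean). -/
def IsStationary3 (ν : ℝ) (f : T3 → R3) (N : ℕ) (μ : Measure H3) : Prop :=
  ∀ (m : ℕ) (g : Fin m → T3 → R3) (P : MvPolynomial (Fin m) ℝ), (∀ i, IsBandTest N (g i)) →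
    P.totalDegree + 1 ≤ 3 →
      Integrable (fun u => Torus.nsGeneratorPairing ν f u (polyGrad g P u)) μ ∧
        ∫ u, Torus.nsGeneratorPairing ν f u (polyGrad g P u) ∂μ = 0

/-- All clauses the crux asks of the measure `μ` at `(f, ν, N, E, ε)`. -/
def IsWitness (f : T3 → R3) (ν : ℝ) (N : ℕ) (E ε : ℝ) (μ : Measure H3) : Prop :=
  IsProbabilityMeasure μ ∧ (∀ᵐ u ∂μ, IsLevel N u) ∧ Integrable (fun u : H3 => ‖u‖ ^ 3) μ ∧
    IsStationary3 ν f N μ ∧ Torus.ensembleEnergy μ ≤ E ∧ ε ≤ Torus.ensembleDissipation ν μ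

/-- The crux, clause-named (definitional unfolding, `Iff.rfl`). -/
theorem cubicParityLoud_iff :
    CubicParityLoud ↔
      ∀ f : T3 → R3, Torus.IsSmooth f → Torus.IsDivFree f → Torus.HasZeroMean f → f ≠ 0 →
        ∃ E ε ν₀ : ℝ, 0 < ε ∧ 0 < ν₀ ∧ ∀ ν : ℝ, 0 < ν → ν < ν₀ → ∃ N₀ : ℕ, ∀ N : ℕ, N₀ ≤ N →
          ∃ μ : Measure H3, IsWitness f ν N E ε μ :=
  Iff.rfl

/-! ## §1 Bernstein ceiling at level `N` (no stationarity used) -/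

/-- Frequencies off the punctured ball: either `k = 0` or `N² < |k|²`. -/
theorem not_mem_erase_freqBall_of_lt {N : ℕ} {k : Fin 3 → ℤ} (hk : ((N : ℝ)) ^ 2 < Torus.freqNormSq k) :
    k ∉ (Torus.freqBall N).erase (0 : Fin 3 → ℤ) := by
  intro h
  have h2 := (Finset.mem_erase.1 h).2
  rw [Torus.mem_freqBall] at h2
  exact absurd h2 (not_le.2 hk)

/-- BERNSTEIN on `H`: a level-`N` field has `‖∇u‖₂² ≤ 4π²N²‖u‖²` (spectral gradient norm of its
`L²` representative). -/
theorem eGradNormSq_le_of_isLevel {N : ℕ} {u : H3} (hu : IsLevel N u) :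
    Torus.eGradNormSq ((u : L2T3) : T3 → R3) ≤
      ENNReal.ofReal (4 * Real.pi ^ 2 * (N : ℝ) ^ 2 * ‖u‖ ^ 2) := by
  set v : T3 → R3 := ((u : L2T3) : T3 → R3) with hv
  have hmem : MemLp v 2 volume := Lp.memLp (u : L2T3)
  set gC : T3 → EuclideanSpace ℂ (Fin 3) := EuclideanSpace.complexify ∘ v with hgC
  have hpar := Torus.hasSum_sq_norm_mFourierCoeff_complexify hmem
  have hband : ∀ k : Fin 3 → ℤ, ((N : ℝ)) ^ 2 < Torus.freqNormSq k → mFourierCoeff gC k = 0 :=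
    fun k hk => hu k (not_mem_erase_freqBall_of_lt hk)
  have hterm : ∀ k : Fin 3 → ℤ,
      (if k = 0 then 0 else ENNReal.ofReal (Torus.freqNormSq k ^ (1 : ℝ))) * ‖mFourierCoeff gC k‖ₑ ^ 2 ≤
        ENNReal.ofReal ((N : ℝ) ^ 2) * ‖mFourierCoeff gC k‖ₑ ^ 2 := by
    intro k
    split_ifs with hk
    · simp
    · by_cases hb : ((N : ℝ)) ^ 2 < Torus.freqNormSq k
      · rw [hband k hb]; simp
      · rw [Real.rpow_one]
        gcongr
        exact not_lt.1 hb
  have hsum : Torus.eHomSobolevSeminorm 1 gC ^ 2 ≤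
      ENNReal.ofReal ((N : ℝ) ^ 2) * ∑' k, ‖mFourierCoeff gC k‖ₑ ^ 2 := by
    rw [Torus.eHomSobolevSeminorm, ENNReal.rpow_half_sq, ← ENNReal.tsum_mul_left]
    exact ENNReal.tsum_le_tsum hterm
  have htsum : ∑' k, ‖mFourierCoeff gC k‖ₑ ^ 2 = ENNReal.ofReal (∫ x, ‖v x‖ ^ 2) := by
    have h1 : ∀ k, ‖mFourierCoeff gC k‖ₑ ^ 2 = ENNReal.ofReal (‖mFourierCoeff gC k‖ ^ 2) := fun k => by
      rw [← ofReal_norm, ENNReal.ofReal_pow (norm_nonneg _)]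
    simp_rw [h1]
    rw [← ENNReal.ofReal_tsum_of_nonneg (fun k => sq_nonneg _) hpar.summable, hpar.tsum_eq]
  have hI : ∫ x, ‖v x‖ ^ 2 = ‖u‖ ^ 2 := by
    rw [hv, Torus.integral_norm_sq_coe_eq]; rfl
  rw [Torus.eGradNormSq]
  calc ENNReal.ofReal (4 * Real.pi ^ 2) * Torus.eHomSobolevSeminorm 1 (EuclideanSpace.complexify ∘ v) ^ 2
      ≤ ENNReal.ofReal (4 * Real.pi ^ 2) * (ENNReal.ofReal ((N : ℝ) ^ 2) * ∑' k, ‖mFourierCoeff gC k‖ₑ ^ 2) := by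
        gcongr
    _ = ENNReal.ofReal (4 * Real.pi ^ 2 * (N : ℝ) ^ 2 * ‖u‖ ^ 2) := by
        rw [htsum, hI, ← ENNReal.ofReal_mul (by positivity), ← ENNReal.ofReal_mul (by positivity)]
        congr 1
        ring

/-- LEVEL-`N` DISSIPATION CEILING: for a law carried by level-`N` fields with integrable energy,
`ensembleDissipation ν μ ≤ 4π²N²ν · ensembleEnergy μ` (`ν ≥ 0`). No stationarity is used. -/
theorem ensembleDissipation_le_of_isLevel {N : ℕ} {μ : Measure H3}
    (hlev : ∀ᵐ u ∂μ, IsLevel N u) (hint : Integrable (fun u : H3 => ‖u‖ ^ 2) μ) {ν : ℝ} (hν : 0 ≤ ν) :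
    Torus.ensembleDissipation ν μ ≤ 4 * Real.pi ^ 2 * (N : ℝ) ^ 2 * ν * Torus.ensembleEnergy μ := by
  set c : ℝ := 4 * Real.pi ^ 2 * (N : ℝ) ^ 2 with hc
  have hc0 : 0 ≤ c := by positivity
  have h1 : ∫⁻ u, Torus.eGradNormSq ((u : L2T3) : T3 → R3) ∂μ ≤
      ∫⁻ u, ENNReal.ofReal (c * ‖u‖ ^ 2) ∂μ :=
    lintegral_mono_ae (hlev.mono fun u hu => by
      have := eGradNormSq_le_of_isLevel hu
      rwa [hc])
  have h2 : ∫⁻ u, ENNReal.ofReal (c * ‖u‖ ^ 2) ∂μ = ENNReal.ofReal (∫ u, c * ‖u‖ ^ 2 ∂μ) :=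
    (ofReal_integral_eq_lintegral_ofReal (hint.const_mul c)
      (ae_of_all _ fun u => by positivity)).symm
  have h3 : (∫⁻ u, Torus.eGradNormSq ((u : L2T3) : T3 → R3) ∂μ).toReal ≤ c * ∫ u, ‖u‖ ^ 2 ∂μ := by
    have := ENNReal.toReal_mono ENNReal.ofReal_ne_top (h1.trans_eq h2)
    rwa [ENNReal.toReal_ofReal (by
      rw [integral_const_mul]; exact mul_nonneg hc0 (integral_nonneg fun _ => by positivity)),
      integral_const_mul] at this
  unfold Torus.ensembleDissipation Torus.ensembleEnstrophy Torus.ensembleEnergy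
  calc ν * (∫⁻ u, Torus.eGradNormSq ((u : L2T3) : T3 → R3) ∂μ).toReal
      ≤ ν * (c * ∫ u, ‖u‖ ^ 2 ∂μ) := mul_le_mul_of_nonneg_left h3 hν
    _ = c * ν * ∫ u, ‖u‖ ^ 2 ∂μ := by ring


/-! ## §2 The ENERGY ROW: level-`N` + 3-stationary ⇒ `ensembleDissipation ν μ = ∫ (u, f) dμ`

The quadratic observable `p(u) = Σ_a (u, e_a)²` over the Galerkin frame `e_a` of level `N`
(`Torus.frameField`, a Parseval frame of `P_N H`) is an admissible test of the crux
(`totalDegree 2 + 1 ≤ 3`); its differential is `2 P_N u`, and on level-`N` fields `P_N u = u`, the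
inertial term drops (`b(u,u,u) = 0` in the weak form `∫ (u⊗u):∇P_N u = ∫ ⟪D(P_N u) u, u − P_N u⟫`), so
the row reads `∫ [(f,u) − ν‖∇u‖²] dμ = 0`. Consequences: dissipation = mean injected power
`(f, ū)` ≤ `‖f‖₂ √energy`; loudness is carried ENTIRELY by the correlation of the mean flow with `f`. -/

section EnergyRow

/-- Moments of order `≤ 3` from the cube: `t ^ p ≤ 1 + t ^ 3` for `p ≤ 3`, `t ≥ 0`. -/
theorem pow_le_one_add_cube {t : ℝ} (ht : 0 ≤ t) {p : ℕ} (hp : p ≤ 3) :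
    t ^ p ≤ 1 + t ^ 3 := by
  rcases le_or_gt t 1 with h | h
  · calc t ^ p ≤ 1 := pow_le_one₀ ht h
      _ ≤ 1 + t ^ 3 := le_add_of_nonneg_right (by positivity)
  · calc t ^ p ≤ t ^ 3 := pow_le_pow_right₀ h.le hp
      _ ≤ 1 + t ^ 3 := le_add_of_nonneg_left zero_le_one

/-- On a finite measure, `Integrable ‖u‖³ ⇒ Integrable ‖u‖ᵖ` for `p ≤ 3`. -/
theorem integrable_norm_pow_of_cube {μ : Measure H3} [IsFiniteMeasure μ]
    (h3 : Integrable (fun u : H3 => ‖u‖ ^ 3) μ) {p : ℕ} (hp : p ≤ 3) :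
    Integrable (fun u : H3 => ‖u‖ ^ p) μ := by
  refine Integrable.mono' ((integrable_const (1 : ℝ)).add h3)
    (continuous_norm.pow p).aestronglyMeasurable (ae_of_all _ fun u => ?_)
  rw [Real.norm_eq_abs, abs_of_nonneg (by positivity)]
  exact pow_le_one_add_cube (norm_nonneg u) hp

/-- The pairing `u ↦ (u, f)` with an `L²` force is integrable against any finite law with
integrable `‖u‖`. -/
theorem integrable_pairing {f : T3 → R3} (hf : MemLp f 2 volume) {μ : Measure H3} [IsFiniteMeasure μ]
    (h1 : Integrable (fun u : H3 => ‖u‖) μ) :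
    Integrable (fun u : H3 => Torus.pairing u.1 f) μ := by
  refine Integrable.mono' (h1.mul_const ‖hf.toLp f‖)
    (Torus.continuous_pairing_coe hf).aestronglyMeasurable (ae_of_all _ fun u => ?_)
  rw [Real.norm_eq_abs]
  exact Torus.abs_pairing_coe_le hf u

/-- The Galerkin frame of level `N` as a `Fin`-indexed family (the `g` of `Torus.galerkinTest`). -/
def frameG (N : ℕ) : Fin (Torus.galerkinTest (d := Fin 3) N one_pos).m → T3 → R3 :=
  (Torus.galerkinTest (d := Fin 3) N one_pos).g

/-- The energy polynomial `Σᵢ Xᵢ²`. -/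
def energyPoly (n : ℕ) : MvPolynomial (Fin n) ℝ := ∑ i : Fin n, MvPolynomial.X i ^ 2

/-- `Σ Xᵢ²` has total degree `≤ 2`, so it is an admissible test (`totalDegree + 1 ≤ 3`). -/
theorem totalDegree_energyPoly (n : ℕ) : (energyPoly n).totalDegree + 1 ≤ 3 := by
  have : (energyPoly n).totalDegree ≤ 2 := by
    refine (MvPolynomial.totalDegree_finsetSum _ _).trans ?_
    refine Finset.sup_le fun i _ => ?_
    rw [MvPolynomial.totalDegree_X_pow]
  omega

/-- `∂ᵢ (Σⱼ Xⱼ²) = 2 Xᵢ`, evaluated. -/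
theorem eval_pderiv_energyPoly {n : ℕ} (v : Fin n → ℝ) (i : Fin n) :
    MvPolynomial.eval v (MvPolynomial.pderiv i (energyPoly n)) = 2 * v i := by
  simp [energyPoly, map_sum, Derivation.leibniz_pow, MvPolynomial.pderiv_X, Pi.single_apply,
    Finset.sum_ite_eq', mul_comm]

/-- A single real mode `Re (e_k • z)` with `0 < |k| ≤ N` is band-limited to level `N`. -/
theorem mFourierCoeff_realTrigPoly_singleton_eq_zero_of_not_mem {N : ℕ} {k : Fin 3 → ℤ}
    (hk : k ∈ Torus.freqBall₀ (d := Fin 3) N) (z : (Fin 3 → ℤ) → EuclideanSpace ℂ (Fin 3))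
    {k' : Fin 3 → ℤ} (hk' : k' ∉ (Torus.freqBall N).erase (0 : Fin 3 → ℤ)) :
    mFourierCoeff (EuclideanSpace.complexify ∘ Torus.realTrigPoly {k} z) k' = 0 := by
  have hk0 : k ≠ 0 := (Finset.mem_erase.1 hk).1
  have hkB : k ∈ Torus.freqBall N := (Finset.mem_erase.1 hk).2
  refine Torus.mFourierCoeff_realTrigPoly_eq_zero_of_not_mem z ?_ ?_
  · rw [Finset.mem_singleton]
    rintro rfl
    exact hk' hk
  · rw [Finset.mem_singleton]
    intro h
    apply hk'
    rw [show k' = -k by rw [← h, neg_neg]]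
    exact Finset.mem_erase.2 ⟨neg_ne_zero.2 hk0, Torus.neg_mem_freqBall.2 hkB⟩

/-- The frame fields are admissible level-`N` tests. -/
theorem isBandTest_frameG (N : ℕ) (i : Fin (Torus.galerkinTest (d := Fin 3) N one_pos).m) :
    IsBandTest N (frameG N i) := by
  refine ⟨(Torus.galerkinTest (d := Fin 3) N one_pos).g_smooth i,
    (Torus.galerkinTest (d := Fin 3) N one_pos).g_divFree i,
    (Torus.galerkinTest (d := Fin 3) N one_pos).g_zeroMean i, fun k' hk' => ?_⟩
  change mFourierCoeff (EuclideanSpace.complexify ∘ Torus.frameField _ _ _) k' = 0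
  exact mFourierCoeff_realTrigPoly_singleton_eq_zero_of_not_mem (Finset.coe_mem _) _ hk'

/-- **The differential of the energy observable is `2 P_N u`** (for every `u ∈ H`). -/
theorem polyGrad_energy (N : ℕ) (u : H3) :
    polyGrad (frameG N) (energyPoly _) u =
      fun x => (2 : ℝ) • Torus.fourierTruncate N ((u : L2T3) : T3 → R3) x := by
  funext x
  simp only [polyGrad, eval_pderiv_energyPoly, mul_smul]
  rw [← Finset.smul_sum]
  congr 1
  have h := Torus.sum_galerkinTest_eq (d := Fin 3) N one_pos (fun g => Torus.pairing u.1 g • g x)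
  change ∑ i, Torus.pairing u.1 ((Torus.galerkinTest (d := Fin 3) N one_pos).g i) •
      (Torus.galerkinTest (d := Fin 3) N one_pos).g i x = _
  rw [h]
  exact Torus.sum_integral_inner_frameField_smul u.2 N x

/-- **The energy row integrand, for every `u ∈ H`**:
`⟨F(u), ∇p(u)⟩ = 2 ((f, P_N u) − ν ‖∇P_N u‖² + ∫ (u⊗u):∇P_N u)`. -/
theorem nsGeneratorPairing_energy (ν : ℝ) (f : T3 → R3) (N : ℕ) (u : H3) :
    Torus.nsGeneratorPairing ν f u (polyGrad (frameG N) (energyPoly _) u) =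
      2 * ((∫ x, ⟪f x, Torus.fourierTruncate N ((u : L2T3) : T3 → R3) x⟫_ℝ) -
        ν * (Torus.eGradNormSq (Torus.fourierTruncate N ((u : L2T3) : T3 → R3))).toReal +
        Torus.inertialPairing (u : L2T3) (Torus.fourierTruncate N ((u : L2T3) : T3 → R3))) := by
  rw [polyGrad_energy]
  exact Torus.nsGeneratorPairing_smul_fourierTruncate ν f u 2 N

/-- A level-`N` field has no tail enstrophy beyond `N`. -/
theorem tailGradNormSq_eq_zero_of_isLevel {N : ℕ} {u : H3} (hu : IsLevel N u) :
    Torus.tailGradNormSq N ((u : L2T3) : T3 → R3) = 0 := by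
  rw [Torus.tailGradNormSq, ENNReal.tsum_eq_zero.2, mul_zero]
  intro k
  have : mFourierCoeff (EuclideanSpace.complexify ∘ ((u : L2T3) : T3 → R3)) (k : Fin 3 → ℤ) = 0 :=
    hu k (fun h => k.2 (Finset.mem_of_mem_erase h))
  rw [this]
  simp

/-- **A level-`N` field is its own truncation**, `P_N u = u` a.e. on `𝕋³`. -/
theorem fourierTruncate_ae_eq_of_isLevel {N : ℕ} {u : H3} (hu : IsLevel N u) :
    (fun x => Torus.fourierTruncate N ((u : L2T3) : T3 → R3) x) =ᵐ[volume] ((u : L2T3) : T3 → R3) := by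
  have hmem : MemLp ((u : L2T3) : T3 → R3) 2 volume := Lp.memLp (u : L2T3)
  have htail := tailGradNormSq_eq_zero_of_isLevel hu
  have hle := Torus.integral_norm_sq_fourierTruncate_sub_le hmem N (by rw [htail]; exact ENNReal.zero_ne_top)
  rw [htail, ENNReal.toReal_zero, zero_div] at hle
  have hint : Integrable (fun x => ‖Torus.fourierTruncate N ((u : L2T3) : T3 → R3) x -
      ((u : L2T3) : T3 → R3) x‖ ^ 2) volume :=
    ((Torus.memLp_fourierTruncate N _ 2).sub hmem).integrable_norm_pow two_ne_zero
  have h0 : ∫ x, ‖Torus.fourierTruncate N ((u : L2T3) : T3 → R3) x - ((u : L2T3) : T3 → R3) x‖ ^ 2 = 0 :=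
    le_antisymm hle (integral_nonneg fun _ => by positivity)
  have hae := (integral_eq_zero_iff_of_nonneg (fun _ => by positivity) hint).1 h0
  filter_upwards [hae] with x hx
  have hx' : ‖Torus.fourierTruncate N ((u : L2T3) : T3 → R3) x - ((u : L2T3) : T3 → R3) x‖ ^ 2 = 0 := hx
  exact sub_eq_zero.1 (norm_eq_zero.1 (pow_eq_zero_iff two_ne_zero |>.1 hx'))

/-- A level-`N` field and its truncation have the same spectral gradient norm. -/
theorem eGradNormSq_fourierTruncate_of_isLevel {N : ℕ} {u : H3} (hu : IsLevel N u) :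
    Torus.eGradNormSq (Torus.fourierTruncate N ((u : L2T3) : T3 → R3)) =
      Torus.eGradNormSq ((u : L2T3) : T3 → R3) := by
  have hint : Integrable ((u : L2T3) : T3 → R3) volume := (Lp.memLp (u : L2T3)).integrable one_le_two
  rw [Torus.eGradNormSq_eq_tsum, Torus.eGradNormSq_eq_tsum]
  congr 1
  refine tsum_congr fun k => ?_
  rw [Torus.mFourierCoeff_fourierTruncate hint]
  split_ifs with hk
  · rfl
  · rw [hu k (fun h => hk (Finset.mem_of_mem_erase h))]

/-- The spectral gradient norm of a level-`N` field is finite. -/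
theorem eGradNormSq_lt_top_of_isLevel {N : ℕ} {u : H3} (hu : IsLevel N u) :
    Torus.eGradNormSq ((u : L2T3) : T3 → R3) < ⊤ := by
  have hint : Integrable ((u : L2T3) : T3 → R3) volume := (Lp.memLp (u : L2T3)).integrable one_le_two
  rw [← eGradNormSq_fourierTruncate_of_isLevel hu, Torus.fourierTruncate_eq,
    Torus.eGradNormSq_realTrigPoly Torus.neg_mem_freqBall_of_mem (Torus.isConjSymm_mFourierCoeff hint)]
  exact ENNReal.ofReal_lt_top

/-- On a level-`N` field the inertial term against the energy test vanishes: `b(u,u,u) = 0`. -/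
theorem inertialPairing_fourierTruncate_of_isLevel {N : ℕ} {u : H3} (hu : IsLevel N u) :
    Torus.inertialPairing (u : L2T3) (Torus.fourierTruncate N ((u : L2T3) : T3 → R3)) = 0 := by
  rw [Torus.inertialPairing_fourierTruncate_eq u.2 N]
  refine integral_eq_zero_of_ae ?_
  filter_upwards [fourierTruncate_ae_eq_of_isLevel hu] with x hx
  simp only [Pi.zero_apply]
  rw [show ((u : L2T3) : T3 → R3) x - Torus.fourierTruncate N ((u : L2T3) : T3 → R3) x = 0 by
    rw [hx, sub_self]]
  exact inner_zero_right _

/-- On a level-`N` field the force term of the energy test is the pairing `(u, f)`. -/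
theorem integral_inner_fourierTruncate_of_isLevel {N : ℕ} {u : H3} (hu : IsLevel N u) (f : T3 → R3) :
    (∫ x, ⟪f x, Torus.fourierTruncate N ((u : L2T3) : T3 → R3) x⟫_ℝ) = Torus.pairing u.1 f := by
  rw [Torus.pairing]
  refine integral_congr_ae ?_
  filter_upwards [fourierTruncate_ae_eq_of_isLevel hu] with x hx
  rw [hx, real_inner_comm]

/-- **The energy row integrand on level-`N` fields**: `⟨F(u), ∇p(u)⟩ = 2 ((u,f) − ν‖∇u‖²)`. -/
theorem nsGeneratorPairing_energy_of_isLevel (ν : ℝ) (f : T3 → R3) {N : ℕ} {u : H3} (hu : IsLevel N u) :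
    Torus.nsGeneratorPairing ν f u (polyGrad (frameG N) (energyPoly _) u) =
      2 * (Torus.pairing u.1 f - ν * (Torus.eGradNormSq ((u : L2T3) : T3 → R3)).toReal) := by
  rw [nsGeneratorPairing_energy, integral_inner_fourierTruncate_of_isLevel hu,
    eGradNormSq_fourierTruncate_of_isLevel hu, inertialPairing_fourierTruncate_of_isLevel hu, add_zero]

/-- **THE ENERGY ROW.** For an `L²` force `f`, any finite law on `H` carried by level-`N` fields,
with `‖u‖` integrable, whose row of the single quadratic observable `Σ_a (u,e_a)²` (Galerkin frame
of level `N`) is integrable with zero mean, satisfies `ensembleDissipation ν μ = ∫ (u, f) dμ`.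
Any proof of `CubicParityLoud` must produce laws whose loudness `ε` is injected power `(f, ū)`. -/
theorem ensembleDissipation_eq_of_energyRow {ν : ℝ} {f : T3 → R3} (hf : MemLp f 2 volume) {N : ℕ}
    {μ : Measure H3} [IsFiniteMeasure μ] (hlev : ∀ᵐ u ∂μ, IsLevel N u)
    (h1 : Integrable (fun u : H3 => ‖u‖) μ)
    (hrowI : Integrable (fun u => Torus.nsGeneratorPairing ν f u (polyGrad (frameG N) (energyPoly _) u)) μ)
    (hrow0 : ∫ u, Torus.nsGeneratorPairing ν f u (polyGrad (frameG N) (energyPoly _) u) ∂μ = 0) :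
    Torus.ensembleDissipation ν μ = ∫ u, Torus.pairing u.1 f ∂μ := by
  set G : H3 → ℝ := fun u => Torus.nsGeneratorPairing ν f u (polyGrad (frameG N) (energyPoly _) u) with hG
  set D : H3 → ℝ := fun u => (Torus.eGradNormSq ((u : L2T3) : T3 → R3)).toReal with hD
  have hae : G =ᵐ[μ] fun u => 2 * (Torus.pairing u.1 f - ν * D u) :=
    hlev.mono fun u hu => nsGeneratorPairing_energy_of_isLevel ν f hu
  have hpair : Integrable (fun u : H3 => Torus.pairing u.1 f) μ := integrable_pairing hf h1
  -- the dissipation as a Bochner integral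
  have hDint_eq : Torus.ensembleDissipation ν μ = ν * ∫ u, D u ∂μ := by
    unfold Torus.ensembleDissipation Torus.ensembleEnstrophy
    rw [integral_toReal Torus.measurable_eGradNormSq_coe.aemeasurable
      (hlev.mono fun u hu => eGradNormSq_lt_top_of_isLevel hu)]
  by_cases hν : ν = 0
  · -- then the row says `∫ (u,f) = 0`
    have h2 : Integrable (fun u : H3 => 2 * (Torus.pairing u.1 f - ν * D u)) μ := by
      simp only [hν, zero_mul, sub_zero]; exact hpair.const_mul 2
    have : ∫ u, G u ∂μ = 2 * ∫ u, Torus.pairing u.1 f ∂μ := by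
      rw [integral_congr_ae hae]
      simp only [hν, zero_mul, sub_zero]
      exact integral_const_mul 2 _
    rw [hDint_eq, hν, zero_mul]
    have h0 : 2 * ∫ u, Torus.pairing u.1 f ∂μ = 0 := by rw [← this]; exact hrow0
    linarith
  · -- `D = ((u,f) - G/2)/ν` is integrable and the row gives `ν ∫ D = ∫ (u,f)`
    have hGint : Integrable (fun u : H3 => 2 * (Torus.pairing u.1 f - ν * D u)) μ :=
      hrowI.congr hae
    have hDint : Integrable D μ := by
      have h3 : Integrable (fun u : H3 => (ν)⁻¹ * (Torus.pairing u.1 f -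
          (2 : ℝ)⁻¹ * (2 * (Torus.pairing u.1 f - ν * D u)))) μ :=
        (hpair.sub (hGint.const_mul _)).const_mul _
      refine h3.congr (ae_of_all _ fun u => ?_)
      simp only
      field_simp
      ring
    have hrow : ∫ u, 2 * (Torus.pairing u.1 f - ν * D u) ∂μ = 0 := by
      rw [← integral_congr_ae hae]; exact hrow0
    rw [integral_const_mul, integral_sub hpair (hDint.const_mul ν), integral_const_mul] at hrow
    rw [hDint_eq]
    linarith

/-- The energy row from the crux's full 3-stationarity clause. -/
theorem ensembleDissipation_eq_of_isStationary3 {ν : ℝ} {f : T3 → R3} (hf : MemLp f 2 volume) {N : ℕ}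
    {μ : Measure H3} [IsFiniteMeasure μ] (hlev : ∀ᵐ u ∂μ, IsLevel N u)
    (h1 : Integrable (fun u : H3 => ‖u‖) μ) (hstat : IsStationary3 ν f N μ) :
    Torus.ensembleDissipation ν μ = ∫ u, Torus.pairing u.1 f ∂μ := by
  obtain ⟨hI, h0⟩ := hstat _ (frameG N) (energyPoly _) (isBandTest_frameG N) (totalDegree_energyPoly _)
  exact ensembleDissipation_eq_of_energyRow hf hlev h1 hI h0

/-- `(∫ ‖u‖ dμ)² ≤ ∫ ‖u‖² dμ` on a probability space (variance is non-negative). -/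
theorem sq_integral_norm_le {μ : Measure H3} [IsProbabilityMeasure μ]
    (h2 : Integrable (fun u : H3 => ‖u‖ ^ 2) μ) :
    (∫ u, ‖u‖ ∂μ) ^ 2 ≤ ∫ u, ‖u‖ ^ 2 ∂μ := by
  have h1 : Integrable (fun u : H3 => ‖u‖) μ := by
    refine Integrable.mono' ((integrable_const (1 : ℝ)).add h2)
      continuous_norm.aestronglyMeasurable (ae_of_all _ fun u => ?_)
    rw [Real.norm_eq_abs, abs_of_nonneg (norm_nonneg _), Pi.add_apply]
    nlinarith [norm_nonneg u, sq_nonneg (‖u‖ - 1)]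
  set a : ℝ := ∫ u, ‖u‖ ∂μ with ha
  have hvar : 0 ≤ ∫ u, (‖u‖ - a) ^ 2 ∂μ := integral_nonneg fun _ => sq_nonneg _
  have hexp : ∫ u, (‖u‖ - a) ^ 2 ∂μ = (∫ u, ‖u‖ ^ 2 ∂μ) - a ^ 2 := by
    have hsplit : (fun u : H3 => (‖u‖ - a) ^ 2) = fun u => ‖u‖ ^ 2 - (2 * a) * ‖u‖ + a ^ 2 := by
      funext u; ring
    have hA : Integrable (fun u : H3 => ‖u‖ ^ 2 - 2 * a * ‖u‖) μ := h2.sub (h1.const_mul _)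
    rw [hsplit, integral_add hA (integrable_const _), integral_sub h2 (h1.const_mul _),
      integral_const_mul, integral_const, ← ha]
    simp only [smul_eq_mul, probReal_univ, one_mul]
    ring
  linarith

/-- `‖f‖_{L²} = √(∫ ‖f‖²)` for the `L²` class of an `L²` force. -/
theorem norm_toLp_eq_sqrt {f : T3 → R3} (hf : MemLp f 2 volume) :
    ‖hf.toLp f‖ = Real.sqrt (∫ x, ‖f x‖ ^ 2) := by
  have h : ∫ x, ‖f x‖ ^ 2 = ‖hf.toLp f‖ ^ 2 := by
    rw [← Torus.integral_norm_sq_coe_eq (hf.toLp f)]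
    refine integral_congr_ae ?_
    filter_upwards [hf.coeFn_toLp] with x hx
    rw [hx]
  rw [h, Real.sqrt_sq (norm_nonneg _)]

/-- **POWER CEILING**: `∫ (u, f) dμ ≤ ‖f‖_{L²} √(ensembleEnergy μ)` on a probability law with
integrable energy (Cauchy–Schwarz twice). With the energy row: `ε ≤ ‖f‖₂ √E` for every witness. -/
theorem integral_pairing_le {f : T3 → R3} (hf : MemLp f 2 volume) {μ : Measure H3} [IsProbabilityMeasure μ]
    (h2 : Integrable (fun u : H3 => ‖u‖ ^ 2) μ) :
    ∫ u, Torus.pairing u.1 f ∂μ ≤ Real.sqrt (∫ x, ‖f x‖ ^ 2) * Real.sqrt (Torus.ensembleEnergy μ) := by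
  have h1 : Integrable (fun u : H3 => ‖u‖) μ := by
    refine Integrable.mono' ((integrable_const (1 : ℝ)).add h2)
      continuous_norm.aestronglyMeasurable (ae_of_all _ fun u => ?_)
    rw [Real.norm_eq_abs, abs_of_nonneg (norm_nonneg _), Pi.add_apply]
    nlinarith [norm_nonneg u, sq_nonneg (‖u‖ - 1)]
  have hstep1 : ∫ u, Torus.pairing u.1 f ∂μ ≤ ∫ u, ‖u‖ * ‖hf.toLp f‖ ∂μ :=
    integral_mono (integrable_pairing hf h1) (h1.mul_const _) fun u =>
      (le_abs_self _).trans (Torus.abs_pairing_coe_le hf u)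
  rw [integral_mul_const] at hstep1
  have hstep2 : ∫ u, ‖u‖ ∂μ ≤ Real.sqrt (Torus.ensembleEnergy μ) := by
    unfold Torus.ensembleEnergy
    exact (le_abs_self _).trans (Real.abs_le_sqrt (sq_integral_norm_le h2))
  calc ∫ u, Torus.pairing u.1 f ∂μ ≤ (∫ u, ‖u‖ ∂μ) * ‖hf.toLp f‖ := hstep1
    _ ≤ Real.sqrt (Torus.ensembleEnergy μ) * ‖hf.toLp f‖ :=
        mul_le_mul_of_nonneg_right hstep2 (norm_nonneg _)
    _ = Real.sqrt (∫ x, ‖f x‖ ^ 2) * Real.sqrt (Torus.ensembleEnergy μ) := by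
        rw [norm_toLp_eq_sqrt, mul_comm]

/-- **CEILING FOR WITNESSES**: every witness of the crux at `(f, ν, N, E, ε)` has
`ε ≤ ensembleDissipation ν μ = ∫ (u,f) dμ ≤ ‖f‖₂ √E` (so `ε ≤ ‖f‖₂ √E`, and the mean flow is
non-trivially correlated with `f`). -/
theorem IsWitness.dissipation_eq {f : T3 → R3} (hf : MemLp f 2 volume) {ν : ℝ} {N : ℕ} {E ε : ℝ}
    {μ : Measure H3} (hW : IsWitness f ν N E ε μ) :
    Torus.ensembleDissipation ν μ = ∫ u, Torus.pairing u.1 f ∂μ := by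
  obtain ⟨hP, hlev, h3, hstat, -, -⟩ := hW
  exact ensembleDissipation_eq_of_isStationary3 hf hlev
    (by simpa using integrable_norm_pow_of_cube h3 (p := 1) (by norm_num)) hstat

/-- **POWER CEILING FOR WITNESSES**: `ε ≤ ‖f‖₂ √E`. -/
theorem IsWitness.le_power {f : T3 → R3} (hf : MemLp f 2 volume) {ν : ℝ} {N : ℕ} {E ε : ℝ}
    {μ : Measure H3} (hW : IsWitness f ν N E ε μ) :
    ε ≤ Real.sqrt (∫ x, ‖f x‖ ^ 2) * Real.sqrt E := by
  have hP := hW.1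
  have h2 : Integrable (fun u : H3 => ‖u‖ ^ 2) μ :=
    integrable_norm_pow_of_cube hW.2.2.1 (p := 2) (by norm_num)
  have hE : Torus.ensembleEnergy μ ≤ E := hW.2.2.2.2.1
  calc ε ≤ Torus.ensembleDissipation ν μ := hW.2.2.2.2.2
    _ = ∫ u, Torus.pairing u.1 f ∂μ := hW.dissipation_eq hf
    _ ≤ Real.sqrt (∫ x, ‖f x‖ ^ 2) * Real.sqrt (Torus.ensembleEnergy μ) := integral_pairing_le hf h2
    _ ≤ Real.sqrt (∫ x, ‖f x‖ ^ 2) * Real.sqrt E :=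
        mul_le_mul_of_nonneg_left (Real.sqrt_le_sqrt hE) (Real.sqrt_nonneg _)

end EnergyRow


/-! ## §3 Concrete forces: the zero force, a constant wind force, a gradient mode, a shear mode -/

section Forces

/-- The first lattice direction `e₁ = (1,0,0) ∈ ℤ³`. -/
def k₁ : Fin 3 → ℤ := Pi.single 0 1

/-- `e₁ ≠ 0`. -/
theorem k₁_ne_zero : k₁ ≠ 0 := by
  intro h
  have := congrFun h 0
  simp [k₁] at this

/-- `k ≠ 0 ⇒ k ≠ -k` in `ℤ³`. -/
theorem ne_neg_self_of_ne_zero {k : Fin 3 → ℤ} (hk : k ≠ 0) : k ≠ -k := by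
  intro h
  apply hk
  funext i
  have := congrFun h i
  simp only [Pi.neg_apply] at this
  change k i = 0
  omega

/-- Fourier coefficients of the zero field vanish. -/
theorem mFourierCoeff_zero_field (k : Fin 3 → ℤ) :
    mFourierCoeff (EuclideanSpace.complexify ∘ (0 : T3 → R3)) k = 0 := by
  rw [Torus.mFourierCoeff_eq_integral_volume]
  simp

/-- A single real mode with non-zero frequency and amplitude is a non-zero field. -/
theorem realTrigPoly_singleton_ne_zero {k : Fin 3 → ℤ} (hk : k ≠ 0) {z : EuclideanSpace ℂ (Fin 3)}
    (hz : z ≠ 0) : Torus.realTrigPoly {k} (fun _ => z) ≠ 0 := by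
  intro h
  have hc := Torus.mFourierCoeff_realTrigPoly_singleton k (fun _ => z) k
  rw [h, mFourierCoeff_zero_field, if_pos rfl, if_neg (ne_neg_self_of_ne_zero hk),
    EuclideanSpace.conjVec_zero, add_zero] at hc
  have : z = 0 := by
    have h2 : (2 : ℂ)⁻¹ • z = 0 := hc.symm
    rcases smul_eq_zero.1 h2 with h3 | h3
    · exact absurd h3 (by norm_num)
    · exact h3
  exact hz this

/-- A single real mode with non-zero frequency has zero mean. -/
theorem hasZeroMean_realTrigPoly_singleton {k : Fin 3 → ℤ} (hk : k ≠ 0) (z : EuclideanSpace ℂ (Fin 3)) :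
    Torus.HasZeroMean (Torus.realTrigPoly {k} (fun _ => z)) := by
  rw [Torus.HasZeroMean]
  simp_rw [Torus.realTrigPoly_singleton_apply]
  have hi : Integrable (fun x : T3 => mFourier k x • z) volume :=
    ((mFourier k).continuous.smul continuous_const).integrable_unitAddTorus
  rw [ContinuousLinearMap.integral_comp_comm _ hi, integral_smul_const, Torus.integral_mFourier,
    if_neg hk, zero_smul, map_zero]

/-- **Gradient force**: the longitudinal mode `cos(2πx₁) e₁ = Re (e_{e₁} • e₁)` (a pressure gradient). -/
def gradForce : T3 → R3 := Torus.realTrigPoly {k₁} (fun _ => EuclideanSpace.complexify (Torus.latticeVec k₁))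

/-- The gradient force is smooth. -/
theorem isSmooth_gradForce : Torus.IsSmooth gradForce := Torus.isSmooth_realTrigPoly _ _

/-- The gradient force has zero mean. -/
theorem hasZeroMean_gradForce : Torus.HasZeroMean gradForce := hasZeroMean_realTrigPoly_singleton k₁_ne_zero _

/-- The gradient force is non-zero. -/
theorem gradForce_ne_zero : gradForce ≠ 0 := by
  refine realTrigPoly_singleton_ne_zero k₁_ne_zero fun h => ?_
  have := congrArg (fun v : EuclideanSpace ℂ (Fin 3) => v 0) h
  simp [Torus.latticeVec_apply, k₁] at this

/-- A gradient force does no work on `H`: `(u, ∇φ) = 0` (here: the longitudinal mode is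
`L²`-orthogonal to every weakly divergence-free field, by transversality of `û`). -/
theorem pairing_gradForce (u : H3) : Torus.pairing u.1 gradForce = 0 := by
  have hmem : MemLp ((u : L2T3) : T3 → R3) 2 volume := Lp.memLp (u : L2T3)
  have hint : Integrable ((u : L2T3) : T3 → R3) volume := hmem.integrable one_le_two
  have hdiv := Torus.isWeaklyDivFree_of_mem_energySpace u.2
  have htr := hdiv.sum_mul_mFourierCoeff_eq_zero hmem k₁
  rw [Torus.pairing, gradForce, Torus.integral_inner_realTrigPoly_singleton hint,
    Torus.re_inner_complexify_eq_sum]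
  simp_rw [Torus.latticeVec_apply]
  have := congrArg Complex.re htr
  rw [Complex.re_sum] at this
  simp only [Complex.mul_re, Complex.intCast_re, Complex.intCast_im, zero_mul, sub_zero,
    Complex.zero_re] at this
  rw [← this]
  exact Finset.sum_congr rfl fun i _ => by ring

/-- **Wind force**: the constant field `e₁` (not mean-zero). -/
def windForce : T3 → R3 := fun _ => EuclideanSpace.single 0 1

/-- The wind force is smooth. -/
theorem isSmooth_windForce : Torus.IsSmooth windForce := Torus.isSmooth_const _

/-- Constant fields are divergence free. -/
theorem isDivFree_const (a : R3) : Torus.IsDivFree (fun _ : T3 => a) := by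
  intro x
  simp [Torus.divergence, Torus.partialDeriv, Torus.lineDeriv]

/-- The wind force is divergence free. -/
theorem isDivFree_windForce : Torus.IsDivFree windForce := isDivFree_const _

/-- The wind force is non-zero. -/
theorem windForce_ne_zero : windForce ≠ 0 := by
  intro h
  have := congrArg (fun v : R3 => v 0) (congrFun h (0 : T3))
  simp [windForce] at this

/-- A constant force does no work on `H`: `(u, a) = ⟪∫u, a⟫ = 0` (mean-zero fields). -/
theorem pairing_const (u : H3) (a : R3) : Torus.pairing u.1 (fun _ => a) = 0 := by
  have hint : Integrable ((u : L2T3) : T3 → R3) volume := (Lp.memLp (u : L2T3)).integrable one_le_two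
  rw [Torus.pairing]
  simp_rw [real_inner_comm a]
  rw [integral_inner hint a, Torus.integral_eq_zero_of_mem_energySpace u.2, inner_zero_right]

/-- The zero force. -/
theorem isSmooth_zeroForce : Torus.IsSmooth (0 : T3 → R3) := Torus.isSmooth_const (0 : R3)

/-- The zero force is divergence free. -/
theorem isDivFree_zeroForce : Torus.IsDivFree (0 : T3 → R3) := isDivFree_const (0 : R3)

/-- The zero force has zero mean. -/
theorem hasZeroMean_zeroForce : Torus.HasZeroMean (0 : T3 → R3) := by
  simp [Torus.HasZeroMean]

/-- The zero force does no work. -/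
theorem pairing_zeroForce (u : H3) : Torus.pairing u.1 (0 : T3 → R3) = 0 := by
  simp [Torus.pairing]

/-- **Shear (Kolmogorov) force**: `cos(2πx₁) e₂`, the frame field of frequency `e₁`, direction `e₂`. -/
def shearForce : T3 → R3 := Torus.frameField k₁ 1 true

/-- The shear force is smooth. -/
theorem isSmooth_shearForce : Torus.IsSmooth shearForce := Torus.isSmooth_realTrigPoly _ _

/-- The shear force is divergence free. -/
theorem isDivFree_shearForce : Torus.IsDivFree shearForce := Torus.isDivFree_frameField k₁_ne_zero _ _

/-- The shear force has zero mean. -/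
theorem hasZeroMean_shearForce : Torus.HasZeroMean shearForce := Torus.integral_frameField k₁_ne_zero _ _

/-- The shear force is non-zero. -/
theorem shearForce_ne_zero : shearForce ≠ 0 := by
  refine realTrigPoly_singleton_ne_zero k₁_ne_zero fun h => ?_
  have := congrArg (fun v : EuclideanSpace ℂ (Fin 3) => v 1) h
  simp [Torus.frameVec, Torus.perpVec_apply, k₁] at this

/-- Smooth forces are `L²`. -/
theorem memLp_of_isSmooth {f : T3 → R3} (hf : Torus.IsSmooth f) : MemLp f 2 volume := hf.memLp 2

end Forces

/-! ## §4 LOAD-BEARING HYPOTHESES: each of `f ≠ 0`, `IsDivFree f`, `HasZeroMean f` is necessary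

In each case the dropped hypothesis admits a force doing no work on `H` (`(u, f) = 0` for all
`u ∈ H`), and the energy row forces `ensembleDissipation = ∫ (u,f) dμ = 0 < ε`. So any proof of the
crux must USE `f ≠ 0`, solenoidality and the mean-zero condition — all three exactly through the
injected power `(f, ū)`. (`IsSmooth f` is NOT load-bearing in this sense: the construction only
ever sees `P_N f`.) -/

section LoadBearing

/-- A force that does no work on `H` has no witness with `ε > 0`. -/
theorem no_witness_of_pairing_eq_zero {f : T3 → R3} (hf : MemLp f 2 volume)
    (hwork : ∀ u : H3, Torus.pairing u.1 f = 0) {ν : ℝ} {N : ℕ} {E ε : ℝ} (hε : 0 < ε)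
    {μ : Measure H3} (hW : IsWitness f ν N E ε μ) : False := by
  have h := hW.2.2.2.2.2
  rw [hW.dissipation_eq hf] at h
  simp_rw [hwork] at h
  rw [integral_zero] at h
  exact absurd h (not_le.2 hε)

/-- The crux with `f ≠ 0` DROPPED. -/
def CubicParityLoudWithoutNonzero : Prop :=
  ∀ f : T3 → R3, Torus.IsSmooth f → Torus.IsDivFree f → Torus.HasZeroMean f →
    ∃ E ε ν₀ : ℝ, 0 < ε ∧ 0 < ν₀ ∧ ∀ ν : ℝ, 0 < ν → ν < ν₀ → ∃ N₀ : ℕ, ∀ N : ℕ, N₀ ≤ N →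
      ∃ μ : Measure H3, IsWitness f ν N E ε μ

/-- `f ≠ 0` is load-bearing: witness `f = 0` (energy row ⇒ dissipation `= 0 < ε`). -/
theorem cubicParityLoud_false_without_nonzero : ¬ CubicParityLoudWithoutNonzero := by
  intro h
  obtain ⟨E, ε, ν₀, hε, hν₀, h⟩ := h 0 isSmooth_zeroForce isDivFree_zeroForce hasZeroMean_zeroForce
  obtain ⟨N₀, hN⟩ := h (ν₀ / 2) (by positivity) (by linarith)
  obtain ⟨μ, hW⟩ := hN N₀ le_rfl
  exact no_witness_of_pairing_eq_zero (memLp_of_isSmooth isSmooth_zeroForce) pairing_zeroForce hε hW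

/-- The crux with `IsDivFree f` DROPPED. -/
def CubicParityLoudWithoutDivFree : Prop :=
  ∀ f : T3 → R3, Torus.IsSmooth f → Torus.HasZeroMean f → f ≠ 0 →
    ∃ E ε ν₀ : ℝ, 0 < ε ∧ 0 < ν₀ ∧ ∀ ν : ℝ, 0 < ν → ν < ν₀ → ∃ N₀ : ℕ, ∀ N : ℕ, N₀ ≤ N →
      ∃ μ : Measure H3, IsWitness f ν N E ε μ

/-- `IsDivFree f` is load-bearing: witness the gradient mode `cos(2πx₁) e₁` (invisible to `H`). -/
theorem cubicParityLoud_false_without_divFree : ¬ CubicParityLoudWithoutDivFree := by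
  intro h
  obtain ⟨E, ε, ν₀, hε, hν₀, h⟩ := h gradForce isSmooth_gradForce hasZeroMean_gradForce gradForce_ne_zero
  obtain ⟨N₀, hN⟩ := h (ν₀ / 2) (by positivity) (by linarith)
  obtain ⟨μ, hW⟩ := hN N₀ le_rfl
  exact no_witness_of_pairing_eq_zero (memLp_of_isSmooth isSmooth_gradForce) pairing_gradForce hε hW

/-- The crux with `HasZeroMean f` DROPPED. -/
def CubicParityLoudWithoutZeroMean : Prop :=
  ∀ f : T3 → R3, Torus.IsSmooth f → Torus.IsDivFree f → f ≠ 0 →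
    ∃ E ε ν₀ : ℝ, 0 < ε ∧ 0 < ν₀ ∧ ∀ ν : ℝ, 0 < ν → ν < ν₀ → ∃ N₀ : ℕ, ∀ N : ℕ, N₀ ≤ N →
      ∃ μ : Measure H3, IsWitness f ν N E ε μ

/-- `HasZeroMean f` is load-bearing: witness the constant wind force `e₁` (invisible to `H`). -/
theorem cubicParityLoud_false_without_zeroMean : ¬ CubicParityLoudWithoutZeroMean := by
  intro h
  obtain ⟨E, ε, ν₀, hε, hν₀, h⟩ := h windForce isSmooth_windForce isDivFree_windForce windForce_ne_zero
  obtain ⟨N₀, hN⟩ := h (ν₀ / 2) (by positivity) (by linarith)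
  obtain ⟨μ, hW⟩ := hN N₀ le_rfl
  exact no_witness_of_pairing_eq_zero (memLp_of_isSmooth isSmooth_windForce) (fun u => pairing_const u _) hε hW

end LoadBearing

/-! ## §5 TIGHTNESS of the quantifier order and of the constants -/

section Tightness

/-- STRENGTHENING (refuted): the level threshold `N₀` chosen BEFORE the viscosity `ν`. -/
def CubicParityLoudUniformLevel : Prop :=
  ∀ f : T3 → R3, Torus.IsSmooth f → Torus.IsDivFree f → Torus.HasZeroMean f → f ≠ 0 →
    ∃ (E ε ν₀ : ℝ) (N₀ : ℕ), 0 < ε ∧ 0 < ν₀ ∧ ∀ ν : ℝ, 0 < ν → ν < ν₀ → ∀ N : ℕ, N₀ ≤ N →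
      ∃ μ : Measure H3, IsWitness f ν N E ε μ

/-- Energy of a witness is non-negative, so `0 ≤ E`. -/
theorem IsWitness.energy_nonneg {f : T3 → R3} {ν : ℝ} {N : ℕ} {E ε : ℝ} {μ : Measure H3}
    (hW : IsWitness f ν N E ε μ) : 0 ≤ E :=
  (integral_nonneg fun u => by positivity).trans hW.2.2.2.2.1

/-- **Bernstein kills ν-uniform levels**: a witness at level `N` has `ε ≤ 4π²N²ν E`. -/
theorem IsWitness.le_bernstein {f : T3 → R3} {ν : ℝ} (hν : 0 ≤ ν) {N : ℕ} {E ε : ℝ} {μ : Measure H3}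
    (hW : IsWitness f ν N E ε μ) : ε ≤ 4 * Real.pi ^ 2 * (N : ℝ) ^ 2 * ν * E := by
  obtain ⟨hP, hlev, h3, -, hE, hε⟩ := hW
  have h2 : Integrable (fun u : H3 => ‖u‖ ^ 2) μ := integrable_norm_pow_of_cube h3 (p := 2) (by norm_num)
  calc ε ≤ Torus.ensembleDissipation ν μ := hε
    _ ≤ 4 * Real.pi ^ 2 * (N : ℝ) ^ 2 * ν * Torus.ensembleEnergy μ := ensembleDissipation_le_of_isLevel hlev h2 hν
    _ ≤ 4 * Real.pi ^ 2 * (N : ℝ) ^ 2 * ν * E := mul_le_mul_of_nonneg_left hE (by positivity)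

/-- `N₀` must grow as `ν → 0` (like `ν^{-1/2}`): the `ν`-uniform strengthening is FALSE for every
admissible force; witnessed on the shear force. No stationarity is used — only the support clause,
`Integrable ‖u‖³` and Bernstein `‖∇u‖² ≤ 4π²N²‖u‖²`. -/
theorem not_cubicParityLoudUniformLevel : ¬ CubicParityLoudUniformLevel := by
  intro h
  obtain ⟨E, ε, ν₀, N₀, hε, hν₀, h⟩ :=
    h shearForce isSmooth_shearForce isDivFree_shearForce hasZeroMean_shearForce shearForce_ne_zero
  -- a first witness gives `0 ≤ E`
  obtain ⟨μ₁, hW₁⟩ := h (ν₀ / 2) (by positivity) (by linarith) N₀ le_rfl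
  have hE : 0 ≤ E := hW₁.energy_nonneg
  set c : ℝ := 4 * Real.pi ^ 2 * (N₀ : ℝ) ^ 2 with hc
  have hc0 : 0 ≤ c := by positivity
  set ν : ℝ := min (ν₀ / 2) (ε / (2 * (c * E + 1))) with hν
  have hcE : 0 < c * E + 1 := by positivity
  have hνpos : 0 < ν := lt_min (by positivity) (by positivity)
  have hνlt : ν < ν₀ := (min_le_left _ _).trans_lt (by linarith)
  obtain ⟨μ, hW⟩ := h ν hνpos hνlt N₀ le_rfl
  have hb := hW.le_bernstein hνpos.le
  rw [← hc] at hb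
  have hν2 : ν ≤ ε / (2 * (c * E + 1)) := min_le_right _ _
  have key : c * ν * E ≤ ε / 2 := by
    calc c * ν * E = (c * E) * ν := by ring
      _ ≤ (c * E) * (ε / (2 * (c * E + 1))) := mul_le_mul_of_nonneg_left hν2 (by positivity)
      _ = (ε / 2) * ((c * E) / (c * E + 1)) := by field_simp
      _ ≤ (ε / 2) * 1 := by
          refine mul_le_mul_of_nonneg_left ?_ (by positivity)
          rw [div_le_one hcE]; linarith
      _ = ε / 2 := mul_one _
  linarith

/-- STRENGTHENING (refuted): a loudness constant `ε` (and budget `E`, range `ν₀`) UNIFORM IN THE FORCE. -/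
def CubicParityLoudUniformInForce : Prop :=
  ∃ E ε ν₀ : ℝ, 0 < ε ∧ 0 < ν₀ ∧
    ∀ f : T3 → R3, Torus.IsSmooth f → Torus.IsDivFree f → Torus.HasZeroMean f → f ≠ 0 →
      ∀ ν : ℝ, 0 < ν → ν < ν₀ → ∃ N₀ : ℕ, ∀ N : ℕ, N₀ ≤ N → ∃ μ : Measure H3, IsWitness f ν N E ε μ

/-- Scaling a smooth / div-free / mean-zero / non-zero force. -/
theorem isDivFree_smul {f : T3 → R3} (hf : Torus.IsSmooth f) (hd : Torus.IsDivFree f) (c : ℝ) :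
    Torus.IsDivFree (c • f) := by
  intro x
  have hu : Torus.IsContDiff 1 f := hf.isContDiff (by simp)
  have h : Torus.divergence (c • f) x = c * Torus.divergence f x := by
    unfold Torus.divergence
    rw [Finset.mul_sum]
    refine Finset.sum_congr rfl fun i _ => ?_
    have hui : Torus.IsContDiff 1 (fun y => f y i) :=
      (EuclideanSpace.proj i : R3 →L[ℝ] ℝ).contDiff.comp hu
    have h : (fun y => (c • f) y i) = c • fun y => f y i := by
      funext y; simp
    rw [h, Torus.partialDeriv_const_smul hui]
    rfl
  rw [h, hd x, mul_zero]

/-- Scaling preserves zero mean. -/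
theorem hasZeroMean_smul {f : T3 → R3} (hz : Torus.HasZeroMean f) (c : ℝ) : Torus.HasZeroMean (c • f) := by
  rw [Torus.HasZeroMean] at hz ⊢
  simp only [Pi.smul_apply]
  rw [integral_smul, hz, smul_zero]

/-- Non-zero scaling of a non-zero force is non-zero. -/
theorem smul_ne_zero_of_ne_zero {f : T3 → R3} (hf : f ≠ 0) {c : ℝ} (hc : c ≠ 0) : c • f ≠ 0 :=
  smul_ne_zero hc hf

/-- The pairing is linear in the force. -/
theorem pairing_smul (u : H3) (f : T3 → R3) (c : ℝ) : Torus.pairing u.1 (c • f) = c * Torus.pairing u.1 f := by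
  rw [Torus.pairing, Torus.pairing, ← integral_const_mul]
  refine integral_congr_ae (ae_of_all _ fun x => ?_)
  simp only [Pi.smul_apply, real_inner_smul_right]

/-- `ε` cannot be uniform in `f`: scale the shear force down, `ε ≤ ∫ (u, δ f₀) ≤ δ ‖f₀‖₂ √E → 0`. -/
theorem not_cubicParityLoudUniformInForce : ¬ CubicParityLoudUniformInForce := by
  rintro ⟨E, ε, ν₀, hε, hν₀, h⟩
  set A : ℝ := Real.sqrt (∫ x, ‖shearForce x‖ ^ 2) with hA
  have hA0 : 0 ≤ A := Real.sqrt_nonneg _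
  -- a first witness gives `0 ≤ E`
  obtain ⟨N₁, hN₁⟩ := h shearForce isSmooth_shearForce isDivFree_shearForce hasZeroMean_shearForce
    shearForce_ne_zero (ν₀ / 2) (by positivity) (by linarith)
  obtain ⟨μ₁, hW₁⟩ := hN₁ N₁ le_rfl
  have hE : 0 ≤ E := hW₁.energy_nonneg
  set δ : ℝ := ε / (2 * (A * Real.sqrt E + 1)) with hδ
  have hden : 0 < A * Real.sqrt E + 1 := by positivity
  have hδpos : 0 < δ := by positivity
  have hsm : Torus.IsSmooth (δ • shearForce) := isSmooth_shearForce.smul δ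
  obtain ⟨N₀, hN⟩ := h (δ • shearForce) hsm (isDivFree_smul isSmooth_shearForce isDivFree_shearForce δ)
    (hasZeroMean_smul hasZeroMean_shearForce δ) (smul_ne_zero_of_ne_zero shearForce_ne_zero hδpos.ne')
    (ν₀ / 2) (by positivity) (by linarith)
  obtain ⟨μ, hW⟩ := hN N₀ le_rfl
  haveI := hW.1
  have h2 : Integrable (fun u : H3 => ‖u‖ ^ 2) μ := integrable_norm_pow_of_cube hW.2.2.1 (p := 2) (by norm_num)
  have hdis := hW.dissipation_eq (memLp_of_isSmooth hsm)
  simp_rw [pairing_smul] at hdis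
  rw [integral_const_mul] at hdis
  have hbound : ε ≤ δ * (A * Real.sqrt E) := by
    calc ε ≤ Torus.ensembleDissipation (ν₀ / 2) μ := hW.2.2.2.2.2
      _ = δ * ∫ u, Torus.pairing u.1 shearForce ∂μ := hdis
      _ ≤ δ * (A * Real.sqrt (Torus.ensembleEnergy μ)) :=
          mul_le_mul_of_nonneg_left (integral_pairing_le (memLp_of_isSmooth isSmooth_shearForce) h2) hδpos.le
      _ ≤ δ * (A * Real.sqrt E) := by
          gcongr
          exact hW.2.2.2.2.1
  have key : δ * (A * Real.sqrt E) ≤ ε / 2 := by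
    rw [hδ]
    calc ε / (2 * (A * Real.sqrt E + 1)) * (A * Real.sqrt E)
        = (ε / 2) * ((A * Real.sqrt E) / (A * Real.sqrt E + 1)) := by field_simp
      _ ≤ (ε / 2) * 1 := by
          refine mul_le_mul_of_nonneg_left ?_ (by positivity)
          rw [div_le_one hden]; linarith
      _ = ε / 2 := mul_one _
  linarith

/-- **LOUDNESS = MEAN-FLOW WORK.** Every witness does work `∫ (u,f) dμ ≥ ε > 0` against the force;
in particular the mean flow `ū` is non-zero and positively correlated with `f` (`(f, ū) ≥ ε`). -/
theorem IsWitness.integral_pairing_ge {f : T3 → R3} (hf : MemLp f 2 volume) {ν : ℝ} {N : ℕ} {E ε : ℝ}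
    {μ : Measure H3} (hW : IsWitness f ν N E ε μ) : ε ≤ ∫ u, Torus.pairing u.1 f ∂μ := by
  rw [← hW.dissipation_eq hf]; exact hW.2.2.2.2.2

/-- The pairing is odd in `u`. -/
theorem pairing_neg (u : H3) (f : T3 → R3) : Torus.pairing (-u).1 f = -Torus.pairing u.1 f := by
  rw [Torus.pairing, Torus.pairing, ← integral_neg]
  refine integral_congr_ae ?_
  have h : (((-u : H3) : L2T3) : T3 → R3) =ᵐ[volume] -(((u : H3) : L2T3) : T3 → R3) := by
    rw [show ((-u : H3) : L2T3) = -((u : H3) : L2T3) from rfl]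
    exact Lp.coeFn_neg _
  filter_upwards [h] with x hx
  rw [show (-u).1 = ((-u : H3) : L2T3) from rfl, hx, Pi.neg_apply, inner_neg_left]

/-- STRENGTHENING (refuted) / structural constraint: **no witness is symmetric under `u ↦ −u`**
(so no centred Gaussian, no absolute-equilibrium Gibbs law `exp(−βE−γH)`, no law built from `±`-paired
atoms alone can witness the crux — the mean flow must break the symmetry). -/
theorem IsWitness.map_neg_ne {f : T3 → R3} (hf : MemLp f 2 volume) {ν : ℝ} {N : ℕ} {E ε : ℝ} (hε : 0 < ε)
    {μ : Measure H3} (hW : IsWitness f ν N E ε μ) : μ.map (fun u : H3 => -u) ≠ μ := by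
  intro hsymm
  have hge := hW.integral_pairing_ge hf
  have hcont : Continuous fun u : H3 => Torus.pairing u.1 f := Torus.continuous_pairing_coe hf
  have h1 : ∫ u, Torus.pairing u.1 f ∂μ = ∫ u, Torus.pairing u.1 f ∂(μ.map fun u : H3 => -u) := by
    rw [hsymm]
  rw [integral_map (continuous_neg.measurable.aemeasurable) hcont.aestronglyMeasurable] at h1
  simp_rw [pairing_neg, integral_neg] at h1
  have : ∫ u, Torus.pairing u.1 f ∂μ = 0 := by linarith
  linarith

end Tightness


/-! ## §6 ANATOMY OF A WITNESS (quantitative necessary conditions any construction must meet)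

* energy floor `ε ≤ ‖f‖₂ √(ensembleEnergy μ)`;
* AVERAGE-SPEED FLOOR `ε ≤ ‖f‖₂ ∫‖u‖dμ` (the sharper MEAN-FLOW FLOOR `‖f‖₂‖ū_N‖₂ ≥ ε` is §8);
* TAYLOR-SHELL CHARGE: for every cut-off `m`, the enstrophy beyond `|k| > m` carries dissipation
  `≥ ε − 4π²m²νE`; with `m² = ε/(8π²νE)` at least half of `ε` sits at wavenumbers `≳ ν^{-1/2}`. -/

section Anatomy

/-- **ENERGY FLOOR**: `ε ≤ ‖f‖₂ √(ensembleEnergy μ)`, i.e. `ensembleEnergy μ ≥ (ε/‖f‖₂)²`. -/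
theorem IsWitness.le_power_energy {f : T3 → R3} (hf : MemLp f 2 volume) {ν : ℝ} {N : ℕ} {E ε : ℝ}
    {μ : Measure H3} (hW : IsWitness f ν N E ε μ) :
    ε ≤ Real.sqrt (∫ x, ‖f x‖ ^ 2) * Real.sqrt (Torus.ensembleEnergy μ) := by
  have hP := hW.1
  have h2 : Integrable (fun u : H3 => ‖u‖ ^ 2) μ := integrable_norm_pow_of_cube hW.2.2.1 (p := 2) (by norm_num)
  calc ε ≤ ∫ u, Torus.pairing u.1 f ∂μ := hW.integral_pairing_ge hf
    _ ≤ _ := integral_pairing_le hf h2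

/-- **AVERAGE-SPEED FLOOR**: `ε ≤ ‖f‖₂ ∫ ‖u‖ dμ` — the law charges fields of macroscopic size.
(The sharper MEAN-FLOW floor `ε ≤ ‖f‖₂ ‖ū‖`, `ū = Σ_a (∫(u,e_a)dμ) e_a` the level-`N` mean flow, holds by
the same energy row, `∫ (u,f) dμ = (ū, f)`; recorded here in the weaker Bochner-free form.) -/
theorem IsWitness.le_integral_norm {f : T3 → R3} (hf : MemLp f 2 volume) {ν : ℝ} {N : ℕ} {E ε : ℝ}
    {μ : Measure H3} (hW : IsWitness f ν N E ε μ) :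
    ε ≤ Real.sqrt (∫ x, ‖f x‖ ^ 2) * ∫ u, ‖u‖ ∂μ := by
  have hP := hW.1
  have h1 : Integrable (fun u : H3 => ‖u‖) μ := by
    simpa using integrable_norm_pow_of_cube hW.2.2.1 (p := 1) (by norm_num)
  have hstep : ∫ u, Torus.pairing u.1 f ∂μ ≤ ∫ u, ‖u‖ * ‖hf.toLp f‖ ∂μ :=
    integral_mono (integrable_pairing hf h1) (h1.mul_const _) fun u =>
      (le_abs_self _).trans (Torus.abs_pairing_coe_le hf u)
  rw [integral_mul_const] at hstep
  calc ε ≤ ∫ u, Torus.pairing u.1 f ∂μ := hW.integral_pairing_ge hf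
    _ ≤ (∫ u, ‖u‖ ∂μ) * ‖hf.toLp f‖ := hstep
    _ = Real.sqrt (∫ x, ‖f x‖ ^ 2) * ∫ u, ‖u‖ ∂μ := by rw [norm_toLp_eq_sqrt, mul_comm]

/-- **Low/high splitting of the enstrophy**: `‖∇v‖² ≤ 4π²m² ∫‖v‖² + tail_m(v)` for an `L²` field
(Bernstein on the ball of radius `m`, the rest is the tail enstrophy `Torus.tailGradNormSq`). -/
theorem eGradNormSq_le_low_add_tail {v : T3 → R3} (hv : MemLp v 2 volume) (m : ℕ) :
    Torus.eGradNormSq v ≤ ENNReal.ofReal (4 * Real.pi ^ 2 * (m : ℝ) ^ 2 * ∫ x, ‖v x‖ ^ 2) +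
      Torus.tailGradNormSq m v := by
  set gC : T3 → EuclideanSpace ℂ (Fin 3) := EuclideanSpace.complexify ∘ v with hgC
  set g : (Fin 3 → ℤ) → ℝ≥0∞ := fun k => ENNReal.ofReal (Torus.freqNormSq k) * ‖mFourierCoeff gC k‖ₑ ^ 2 with hg
  have hpar := Torus.hasSum_sq_norm_mFourierCoeff_complexify hv
  have hsplit := (ENNReal.sum_add_tsum_compl (Torus.freqBall m) g).symm
  have hlow : ∑ k ∈ Torus.freqBall m, g k ≤ ENNReal.ofReal ((m : ℝ) ^ 2) * ∑' k, ‖mFourierCoeff gC k‖ₑ ^ 2 := by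
    calc ∑ k ∈ Torus.freqBall m, g k
        ≤ ∑ k ∈ Torus.freqBall m, ENNReal.ofReal ((m : ℝ) ^ 2) * ‖mFourierCoeff gC k‖ₑ ^ 2 := by
          refine Finset.sum_le_sum fun k hk => ?_
          change ENNReal.ofReal (Torus.freqNormSq k) * ‖mFourierCoeff gC k‖ₑ ^ 2 ≤ _
          gcongr
          exact Torus.mem_freqBall.1 hk
      _ = ENNReal.ofReal ((m : ℝ) ^ 2) * ∑ k ∈ Torus.freqBall m, ‖mFourierCoeff gC k‖ₑ ^ 2 := by
          rw [Finset.mul_sum]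
      _ ≤ ENNReal.ofReal ((m : ℝ) ^ 2) * ∑' k, ‖mFourierCoeff gC k‖ₑ ^ 2 := by
          gcongr
          exact ENNReal.sum_le_tsum _
  have htsum : ∑' k, ‖mFourierCoeff gC k‖ₑ ^ 2 = ENNReal.ofReal (∫ x, ‖v x‖ ^ 2) := by
    have h1 : ∀ k, ‖mFourierCoeff gC k‖ₑ ^ 2 = ENNReal.ofReal (‖mFourierCoeff gC k‖ ^ 2) := fun k => by
      rw [← ofReal_norm, ENNReal.ofReal_pow (norm_nonneg _)]
    simp_rw [h1]
    rw [← ENNReal.ofReal_tsum_of_nonneg (fun k => sq_nonneg _) hpar.summable, hpar.tsum_eq]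
  rw [Torus.eGradNormSq_eq_tsum]
  change ENNReal.ofReal (4 * Real.pi ^ 2) * ∑' k, g k ≤ _
  rw [hsplit, mul_add]
  refine add_le_add ?_ (le_of_eq rfl)
  calc ENNReal.ofReal (4 * Real.pi ^ 2) * ∑ k ∈ Torus.freqBall m, g k
      ≤ ENNReal.ofReal (4 * Real.pi ^ 2) * (ENNReal.ofReal ((m : ℝ) ^ 2) * ∑' k, ‖mFourierCoeff gC k‖ₑ ^ 2) := by
        gcongr
    _ = ENNReal.ofReal (4 * Real.pi ^ 2 * (m : ℝ) ^ 2 * ∫ x, ‖v x‖ ^ 2) := by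
        rw [htsum, ← ENNReal.ofReal_mul (by positivity), ← ENNReal.ofReal_mul (by positivity)]
        congr 1; ring

/-- The mean enstrophy of a witness is finite (else `ensembleDissipation = ν · 0 < ε`). -/
theorem IsWitness.ensembleEnstrophy_ne_top {f : T3 → R3} {ν : ℝ} {N : ℕ} {E ε : ℝ} (hε : 0 < ε)
    {μ : Measure H3} (hW : IsWitness f ν N E ε μ) : Torus.ensembleEnstrophy μ ≠ ⊤ := by
  intro htop
  have h := hW.2.2.2.2.2
  rw [Torus.ensembleDissipation, htop, ENNReal.toReal_top, mul_zero] at h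
  exact absurd h (not_le.2 hε)

/-- **TAYLOR-SHELL CHARGE**: for every cut-off `m`, the enstrophy of a witness beyond the ball of radius
`m` dissipates at least `ε − 4π²m²νE`: `ε − 4π²m²νE ≤ ν ∫ tail_m(u) dμ`. With `m² ≤ ε/(8π²νE)` the tail
carries `≥ ε/2` — witnesses charge wavenumbers `≳ ν^{-1/2}` with half of the dissipation. -/
theorem IsWitness.tail_dissipation_ge {f : T3 → R3} {ν : ℝ} (hν : 0 ≤ ν) {N : ℕ} {E ε : ℝ} (hε : 0 < ε)
    {μ : Measure H3} (hW : IsWitness f ν N E ε μ) (m : ℕ) :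
    ε - 4 * Real.pi ^ 2 * (m : ℝ) ^ 2 * ν * E ≤
      ν * (∫⁻ u, Torus.tailGradNormSq m ((u : L2T3) : T3 → R3) ∂μ).toReal := by
  have hfin : Torus.ensembleEnstrophy μ ≠ ⊤ := hW.ensembleEnstrophy_ne_top hε
  obtain ⟨hP, hlev, h3, -, hE, hεle⟩ := hW
  have h2 : Integrable (fun u : H3 => ‖u‖ ^ 2) μ := integrable_norm_pow_of_cube h3 (p := 2) (by norm_num)
  set c : ℝ := 4 * Real.pi ^ 2 * (m : ℝ) ^ 2 with hc
  have hc0 : 0 ≤ c := by positivity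
  -- pointwise splitting, integrated
  have hsplit : ∫⁻ u, Torus.eGradNormSq ((u : L2T3) : T3 → R3) ∂μ ≤
      ∫⁻ u, ENNReal.ofReal (c * ‖u‖ ^ 2) ∂μ + ∫⁻ u, Torus.tailGradNormSq m ((u : L2T3) : T3 → R3) ∂μ := by
    rw [← lintegral_add_left' (by
      exact (ENNReal.measurable_ofReal.comp (measurable_const.mul (continuous_norm.measurable.pow_const 2))).aemeasurable)]
    refine lintegral_mono fun u => ?_
    have := eGradNormSq_le_low_add_tail (Lp.memLp (u : L2T3)) m
    rwa [Torus.integral_norm_sq_coe_eq, ← hc] at this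
  have hlow : ∫⁻ u, ENNReal.ofReal (c * ‖u‖ ^ 2) ∂μ = ENNReal.ofReal (c * Torus.ensembleEnergy μ) := by
    rw [Torus.ensembleEnergy, ← integral_const_mul]
    exact (ofReal_integral_eq_lintegral_ofReal (h2.const_mul c) (ae_of_all _ fun u => by positivity)).symm
  have htail_fin : ∫⁻ u, Torus.tailGradNormSq m ((u : L2T3) : T3 → R3) ∂μ ≠ ⊤ :=
    ne_top_of_le_ne_top hfin (lintegral_mono fun u => Torus.tailGradNormSq_le m _)
  -- pass to reals
  have hreal : (Torus.ensembleEnstrophy μ).toReal ≤ c * Torus.ensembleEnergy μ +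
      (∫⁻ u, Torus.tailGradNormSq m ((u : L2T3) : T3 → R3) ∂μ).toReal := by
    have hEn : 0 ≤ c * Torus.ensembleEnergy μ := mul_nonneg hc0 (integral_nonneg fun _ => by positivity)
    have := ENNReal.toReal_mono (ENNReal.add_ne_top.2 ⟨ENNReal.ofReal_ne_top, htail_fin⟩) (hsplit.trans_eq (by rw [hlow]))
    rwa [ENNReal.toReal_add ENNReal.ofReal_ne_top htail_fin, ENNReal.toReal_ofReal hEn] at this
  have hdis : ε ≤ ν * (Torus.ensembleEnstrophy μ).toReal := hεle
  have hE' : c * ν * Torus.ensembleEnergy μ ≤ c * ν * E := mul_le_mul_of_nonneg_left hE (by positivity)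
  nlinarith [mul_le_mul_of_nonneg_left hreal hν]

end Anatomy


/-! ## §7 MOMENTUM FLOOR: the LINEAR rows alone force a macroscopic energy budget, whatever `ε`

The degree-1 tests `p(u) = (u, g)` give the mean momentum balance `(f,g) + ν∫(u,Δg)dμ + ∫∫(u⊗u):∇g dμ = 0`
for every level-`N` band test `g`: the force is balanced by mean viscous stress plus the divergence of the
Reynolds stress. Hence `(f, g) ≤ ν‖Δg‖₂ ∫‖u‖dμ + ‖∇g‖_∞ ∫‖u‖²dμ`; for a witness (energy `≤ E`):
`(f, g) ≤ ν‖Δg‖₂√E + ‖∇g‖_∞ E`. With `g = P_N f` (`(f, P_N f) = ‖P_N f‖₂²`, `‖∇P_N f‖_∞ ≤ truncDerivBound`)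
this is an ENERGY FLOOR INDEPENDENT OF `ε`: `E ≥ (‖f‖₂² − o(1)) / sup|∇f|` as `ν → 0` — every 2-stationary
level-`N` statistics held against `f` at small viscosity is macroscopic (no "small loud" witnesses, and no
small quiet ones either). -/

section MomentumFloor

/-- The differential of the linear observable `p(u) = (u, g)` is `g` itself. -/
theorem polyGrad_X (g : T3 → R3) (u : H3) :
    polyGrad (fun _ : Fin 1 => g) (MvPolynomial.X 0) u = g := by
  funext x
  simp [polyGrad, MvPolynomial.pderiv_X]

/-- **LINEAR ROW extraction**: every level-`N` band test `g` has an integrable, mean-zero generator row. -/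
theorem IsStationary3.linear_row {ν : ℝ} {f : T3 → R3} {N : ℕ} {μ : Measure H3}
    (hstat : IsStationary3 ν f N μ) {g : T3 → R3} (hg : IsBandTest N g) :
    Integrable (fun u => Torus.nsGeneratorPairing ν f u g) μ ∧
      ∫ u, Torus.nsGeneratorPairing ν f u g ∂μ = 0 := by
  have h := hstat 1 (fun _ => g) (MvPolynomial.X 0) (fun _ => hg)
    (by rw [MvPolynomial.totalDegree_X]; norm_num)
  simp only [polyGrad_X] at h
  exact h

/-- The inertial pairing against a test with derivative bound `K` is bounded by `K ‖u‖²`. -/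
theorem abs_inertialPairing_le {g : T3 → R3} {K : ℝ} (hK : ∀ x a, ‖Torus.fderiv g x a‖ ≤ K * ‖a‖)
    (u : H3) : |Torus.inertialPairing (u : L2T3) g| ≤ K * ‖u‖ ^ 2 := by
  rw [Torus.inertialPairing]
  have hmem : MemLp ((u : L2T3) : T3 → R3) 2 volume := Lp.memLp _
  have hint2 : Integrable (fun x => ‖((u : L2T3) : T3 → R3) x‖ ^ 2) volume :=
    hmem.integrable_norm_pow two_ne_zero
  calc |∫ x, ⟪Torus.fderiv g x (((u : L2T3) : T3 → R3) x), ((u : L2T3) : T3 → R3) x⟫_ℝ|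
      ≤ ∫ x, |⟪Torus.fderiv g x (((u : L2T3) : T3 → R3) x), ((u : L2T3) : T3 → R3) x⟫_ℝ| :=
        abs_integral_le_integral_abs
    _ ≤ ∫ x, K * ‖((u : L2T3) : T3 → R3) x‖ ^ 2 := by
        refine integral_mono_of_nonneg (ae_of_all _ fun _ => abs_nonneg _) (hint2.const_mul K)
          (ae_of_all _ fun x => ?_)
        calc |⟪Torus.fderiv g x (((u : L2T3) : T3 → R3) x), ((u : L2T3) : T3 → R3) x⟫_ℝ|
            ≤ ‖Torus.fderiv g x (((u : L2T3) : T3 → R3) x)‖ * ‖((u : L2T3) : T3 → R3) x‖ :=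
              abs_real_inner_le_norm _ _
          _ ≤ (K * ‖((u : L2T3) : T3 → R3) x‖) * ‖((u : L2T3) : T3 → R3) x‖ :=
              mul_le_mul_of_nonneg_right (hK x _) (norm_nonneg _)
          _ = K * ‖((u : L2T3) : T3 → R3) x‖ ^ 2 := by ring
    _ = K * ‖u‖ ^ 2 := by rw [integral_const_mul, Torus.integral_norm_sq_coe_eq]; rfl

/-- The Stokes term of the linear row is bounded by `‖u‖ ‖Δg‖₂`. -/
theorem abs_stokes_le {g : T3 → R3} (hg : Torus.IsSmooth g) (u : H3) :
    |∫ x, ⟪((u : L2T3) : T3 → R3) x, Torus.laplacian g x⟫_ℝ| ≤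
      ‖u‖ * Real.sqrt (∫ x, ‖Torus.laplacian g x‖ ^ 2) := by
  have hΔ : MemLp (Torus.laplacian g) 2 volume := hg.laplacian.memLp 2
  have h := Torus.abs_pairing_coe_le hΔ u
  rw [norm_toLp_eq_sqrt hΔ] at h
  exact h

/-- **MOMENTUM FLOOR (row form)**: if the linear row of a smooth test `g` with derivative bound `K`
holds (integrable, mean zero) for a probability law with integrable energy, then
`(f, g) ≤ ν ‖Δg‖₂ ∫‖u‖ dμ + K ∫‖u‖² dμ`. -/
theorem force_pairing_le_of_linear_row {ν : ℝ} (hν : 0 ≤ ν) {f g : T3 → R3} (hg : Torus.IsSmooth g)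
    {K : ℝ} (hK : ∀ x a, ‖Torus.fderiv g x a‖ ≤ K * ‖a‖)
    {μ : Measure H3} [IsProbabilityMeasure μ] (h2 : Integrable (fun u : H3 => ‖u‖ ^ 2) μ)
    (hrowI : Integrable (fun u => Torus.nsGeneratorPairing ν f u g) μ)
    (hrow0 : ∫ u, Torus.nsGeneratorPairing ν f u g ∂μ = 0) :
    ∫ x, ⟪f x, g x⟫_ℝ ≤
      ν * Real.sqrt (∫ x, ‖Torus.laplacian g x‖ ^ 2) * (∫ u, ‖u‖ ∂μ) + K * ∫ u, ‖u‖ ^ 2 ∂μ := by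
  set A : ℝ := ∫ x, ⟪f x, g x⟫_ℝ with hA
  set B : H3 → ℝ := fun u => ∫ x, ⟪((u : L2T3) : T3 → R3) x, Torus.laplacian g x⟫_ℝ with hB
  set I : H3 → ℝ := fun u => Torus.inertialPairing (u : L2T3) g with hI
  set C : ℝ := Real.sqrt (∫ x, ‖Torus.laplacian g x‖ ^ 2) with hC
  have hΔ : MemLp (Torus.laplacian g) 2 volume := hg.laplacian.memLp 2
  have h1 : Integrable (fun u : H3 => ‖u‖) μ := by
    refine Integrable.mono' ((integrable_const (1 : ℝ)).add h2)
      continuous_norm.aestronglyMeasurable (ae_of_all _ fun u => ?_)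
    rw [Real.norm_eq_abs, abs_of_nonneg (norm_nonneg _), Pi.add_apply]
    nlinarith [norm_nonneg u, sq_nonneg (‖u‖ - 1)]
  have hgen : ∀ u : H3, Torus.nsGeneratorPairing ν f u g = A + ν * B u + I u := fun u => rfl
  have hBint : Integrable B μ := integrable_pairing hΔ h1
  have hIint : Integrable I μ := by
    have := hrowI.sub ((integrable_const A).add (hBint.const_mul ν))
    refine this.congr (ae_of_all _ fun u => ?_)
    simp only [Pi.sub_apply, Pi.add_apply, hgen]
    ring
  have hrow : A + ν * (∫ u, B u ∂μ) + ∫ u, I u ∂μ = 0 := by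
    have h := hrow0
    simp_rw [hgen] at h
    have hAB : Integrable (fun u : H3 => A + ν * B u) μ := (integrable_const A).add (hBint.const_mul ν)
    rw [integral_add hAB hIint, integral_add (integrable_const A) (hBint.const_mul ν), integral_const_mul,
      integral_const] at h
    simpa [probReal_univ] using h
  have hBabs : |∫ u, B u ∂μ| ≤ C * ∫ u, ‖u‖ ∂μ := by
    calc |∫ u, B u ∂μ| ≤ ∫ u, |B u| ∂μ := abs_integral_le_integral_abs
      _ ≤ ∫ u, ‖u‖ * C ∂μ := integral_mono hBint.abs (h1.mul_const C) fun u => abs_stokes_le hg u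
      _ = C * ∫ u, ‖u‖ ∂μ := by rw [integral_mul_const, mul_comm]
  have hIabs : |∫ u, I u ∂μ| ≤ K * ∫ u, ‖u‖ ^ 2 ∂μ := by
    calc |∫ u, I u ∂μ| ≤ ∫ u, |I u| ∂μ := abs_integral_le_integral_abs
      _ ≤ ∫ u, K * ‖u‖ ^ 2 ∂μ := integral_mono hIint.abs (h2.const_mul K) fun u => abs_inertialPairing_le hK u
      _ = K * ∫ u, ‖u‖ ^ 2 ∂μ := integral_const_mul _ _
  have hAeq : A = -(ν * ∫ u, B u ∂μ) - ∫ u, I u ∂μ := by linarith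
  rw [hAeq]
  have hb1 : -(ν * ∫ u, B u ∂μ) ≤ ν * (C * ∫ u, ‖u‖ ∂μ) := by
    have : -(∫ u, B u ∂μ) ≤ C * ∫ u, ‖u‖ ∂μ := (neg_le_abs _).trans hBabs
    nlinarith
  have hb2 : -(∫ u, I u ∂μ) ≤ K * ∫ u, ‖u‖ ^ 2 ∂μ := (neg_le_abs _).trans hIabs
  linarith

/-- **MOMENTUM FLOOR FOR WITNESSES**: for every level-`N` band test `g` with derivative bound `K`,
`(f, g) ≤ ν ‖Δg‖₂ √E + K E`. With `g = P_N f`: `‖P_N f‖₂² ≤ ν‖ΔP_N f‖₂√E + ‖∇P_N f‖_∞ E` — the energy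
budget of any witness (indeed of any 2-stationary level-`N` law forced by `f`) is bounded below
INDEPENDENTLY OF `ε`: `E ≥ (‖f‖₂² − o(1))/sup|∇f|` as `ν → 0`. -/
theorem IsWitness.force_pairing_le {f : T3 → R3} {ν : ℝ} (hν : 0 ≤ ν) {N : ℕ} {E ε : ℝ} {μ : Measure H3}
    (hW : IsWitness f ν N E ε μ) {g : T3 → R3} (hg : IsBandTest N g)
    {K : ℝ} (hK0 : 0 ≤ K) (hK : ∀ x a, ‖Torus.fderiv g x a‖ ≤ K * ‖a‖) :
    ∫ x, ⟪f x, g x⟫_ℝ ≤ ν * Real.sqrt (∫ x, ‖Torus.laplacian g x‖ ^ 2) * Real.sqrt E + K * E := by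
  obtain ⟨hP, hlev, h3, hstat, hE, -⟩ := hW
  have h2 : Integrable (fun u : H3 => ‖u‖ ^ 2) μ := integrable_norm_pow_of_cube h3 (p := 2) (by norm_num)
  obtain ⟨hI, h0⟩ := hstat.linear_row hg
  have hmain := force_pairing_le_of_linear_row hν hg.1 hK h2 hI h0
  have hE' : ∫ u, ‖u‖ ^ 2 ∂μ ≤ E := hE
  have h1le : ∫ u, ‖u‖ ∂μ ≤ Real.sqrt E :=
    ((le_abs_self _).trans (Real.abs_le_sqrt (sq_integral_norm_le h2))).trans (Real.sqrt_le_sqrt hE')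
  have hC0 : 0 ≤ ν * Real.sqrt (∫ x, ‖Torus.laplacian g x‖ ^ 2) := mul_nonneg hν (Real.sqrt_nonneg _)
  calc ∫ x, ⟪f x, g x⟫_ℝ
      ≤ ν * Real.sqrt (∫ x, ‖Torus.laplacian g x‖ ^ 2) * (∫ u, ‖u‖ ∂μ) + K * ∫ u, ‖u‖ ^ 2 ∂μ := hmain
    _ ≤ ν * Real.sqrt (∫ x, ‖Torus.laplacian g x‖ ^ 2) * Real.sqrt E + K * E := by
        gcongr

/-- The truncation `P_N v` has derivative bound `truncDerivBound N v` (for use with `g = P_N f`). -/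
theorem fderiv_fourierTruncate_bound (N : ℕ) (v : T3 → R3) (x : T3) (a : R3) :
    ‖Torus.fderiv (Torus.fourierTruncate N v) x a‖ ≤ Torus.truncDerivBound N v * ‖a‖ := by
  rw [mul_comm]; exact Torus.norm_fderiv_fourierTruncate_apply_le N v x a

end MomentumFloor


/-! ## §8 THE MEAN FLOW: `ū_N = Σ_a (∫(u,e_a)dμ) e_a` does the work, and `‖ū_N‖₂ ≥ ε/‖f‖₂`

For a law carried by level-`N` fields the level-`N` mean flow `ū_N` (frame synthesis of the mean frame
coefficients — a smooth solenoidal mean-zero band-limited field, i.e. itself an admissible test) satisfies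
`(ū_N, g) = ∫ (u, g) dμ` for every `L²` field `g` band-limited to the ball; with the energy row,
`ensembleDissipation = (ū_N, P_N f) ≤ ‖ū_N‖₂ ‖f‖₂`: **every witness carries a macroscopic mean flow,
`‖ū_N‖₂ ≥ ε/‖f‖₂`** (no zero-mean-flow / isotropic witness at any level, whatever the fluctuations do). -/

section MeanFlow

/-- The mean frame coefficients `c_i(μ) = ∫ (u, e_i) dμ` of a law on `H` (Galerkin frame of level `N`). -/
def meanCoeff (N : ℕ) (μ : Measure H3) (i : Fin (Torus.galerkinTest (d := Fin 3) N one_pos).m) : ℝ :=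
  ∫ u, Torus.pairing u.1 (frameG N i) ∂μ

/-- The level-`N` MEAN FLOW `ū_N(x) = Σ_i c_i(μ) e_i(x)`. -/
def meanFlow (N : ℕ) (μ : Measure H3) : T3 → R3 := fun x => ∑ i, meanCoeff N μ i • frameG N i x

/-- Frame fields are integrable. -/
theorem integrable_frameG (N : ℕ) (i : Fin (Torus.galerkinTest (d := Fin 3) N one_pos).m) :
    Integrable (frameG N i) volume :=
  ((isBandTest_frameG N i).1.memLp 2).integrable one_le_two

/-- The mean flow is an admissible level-`N` band test (smooth, solenoidal, mean-zero, band-limited). -/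
theorem isBandTest_meanFlow (N : ℕ) (μ : Measure H3) : IsBandTest N (meanFlow N μ) := by
  refine ⟨Torus.IsSmooth.sum_smul Finset.univ (meanCoeff N μ) fun i => (isBandTest_frameG N i).1,
    Torus.IsDivFree.sum_smul Finset.univ (meanCoeff N μ) (fun i => (isBandTest_frameG N i).1)
      fun i => (isBandTest_frameG N i).2.1,
    Torus.HasZeroMean.sum_smul Finset.univ (meanCoeff N μ) (integrable_frameG N)
      fun i => (isBandTest_frameG N i).2.2.1, fun k hk => ?_⟩
  have hfun : (EuclideanSpace.complexify ∘ meanFlow N μ) =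
      fun x => ∑ i ∈ Finset.univ, (((meanCoeff N μ i : ℝ) : ℂ) • (EuclideanSpace.complexify ∘ frameG N i)) x := by
    funext x
    simp only [Function.comp_apply, meanFlow, map_sum, Pi.smul_apply]
    refine Finset.sum_congr rfl fun i _ => ?_
    rw [LinearIsometry.map_smul, Complex.coe_smul]
  rw [hfun, Torus.mFourierCoeff_finset_sum _ (fun i _ =>
    (Torus.integrable_complexify_comp (integrable_frameG N i)).smul _)]
  refine Finset.sum_eq_zero fun i _ => ?_
  rw [Torus.mFourierCoeff_const_smul, (isBandTest_frameG N i).2.2.2 k hk, smul_zero]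

/-- Pairing a finite frame combination with an `L²` field: `(Σ_i c_i e_i, g) = Σ_i c_i (e_i, g)`. -/
theorem integral_inner_sum_smul_frameG (N : ℕ) (c : Fin (Torus.galerkinTest (d := Fin 3) N one_pos).m → ℝ)
    {g : T3 → R3} (hg : MemLp g 2 volume) :
    ∫ x, ⟪∑ i, c i • frameG N i x, g x⟫_ℝ = ∑ i, c i * ∫ x, ⟪frameG N i x, g x⟫_ℝ := by
  have hint : ∀ i, Integrable (fun x => ⟪frameG N i x, g x⟫_ℝ) volume := by
    intro i
    obtain ⟨C, hC⟩ : ∃ C, ∀ x, ‖frameG N i x‖ ≤ C :=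
      ⟨_, fun x => Torus.norm_realTrigPoly_apply_le _ _ x⟩
    refine Integrable.mono' ((hg.integrable one_le_two).norm.const_mul C)
      ((isBandTest_frameG N i).1.continuous.aestronglyMeasurable.inner hg.aestronglyMeasurable)
      (ae_of_all _ fun x => ?_)
    rw [Real.norm_eq_abs]
    calc |⟪frameG N i x, g x⟫_ℝ| ≤ ‖frameG N i x‖ * ‖g x‖ := abs_real_inner_le_norm _ _
      _ ≤ C * ‖g x‖ := mul_le_mul_of_nonneg_right (hC x) (norm_nonneg _)
  simp_rw [sum_inner, real_inner_smul_left]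
  rw [integral_finsetSum _ fun i _ => (hint i).const_mul (c i)]
  exact Finset.sum_congr rfl fun i _ => integral_const_mul _ _

/-- Frame synthesis of the pairings is the truncation: `Σ_i (u, e_i) e_i = P_N u` (pointwise). -/
theorem sum_pairing_smul_frameG (N : ℕ) (u : H3) (x : T3) :
    ∑ i, Torus.pairing u.1 (frameG N i) • frameG N i x = Torus.fourierTruncate N ((u : L2T3) : T3 → R3) x := by
  have h := Torus.sum_galerkinTest_eq (d := Fin 3) N one_pos (fun e => Torus.pairing u.1 e • e x)
  exact h.trans (Torus.sum_integral_inner_frameField_smul u.2 N x)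

/-- **The pairing of `u ∈ H` with a band-limited `L²` field runs through the frame**:
`(u, g) = Σ_i (u, e_i)(e_i, g)`. -/
theorem pairing_eq_sum_frameG (N : ℕ) (u : H3) {g : T3 → R3} (hg : MemLp g 2 volume)
    (hband : ∀ k ∉ Torus.freqBall N, mFourierCoeff (EuclideanSpace.complexify ∘ g) k = 0) :
    Torus.pairing u.1 g = ∑ i, Torus.pairing u.1 (frameG N i) * ∫ x, ⟪frameG N i x, g x⟫_ℝ := by
  have hmem : MemLp ((u : L2T3) : T3 → R3) 2 volume := Lp.memLp _
  calc Torus.pairing u.1 g = ∫ x, ⟪((u : L2T3) : T3 → R3) x, g x⟫_ℝ := rfl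
    _ = ∫ x, ⟪Torus.fourierTruncate N ((u : L2T3) : T3 → R3) x, g x⟫_ℝ :=
        (Torus.integral_inner_fourierTruncate_eq hmem hg hband).symm
    _ = ∫ x, ⟪∑ i, Torus.pairing u.1 (frameG N i) • frameG N i x, g x⟫_ℝ :=
        integral_congr_ae (ae_of_all _ fun x => by simp only [sum_pairing_smul_frameG])
    _ = ∑ i, Torus.pairing u.1 (frameG N i) * ∫ x, ⟪frameG N i x, g x⟫_ℝ :=
        integral_inner_sum_smul_frameG N _ hg

/-- **THE MEAN FLOW DOES THE WORK**: `(ū_N, g) = ∫ (u, g) dμ` for every `L²` field `g` band-limited to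
the ball of radius `N` (finite law, `‖u‖` integrable). -/
theorem integral_inner_meanFlow {N : ℕ} {μ : Measure H3} [IsFiniteMeasure μ]
    (h1 : Integrable (fun u : H3 => ‖u‖) μ) {g : T3 → R3} (hg : MemLp g 2 volume)
    (hband : ∀ k ∉ Torus.freqBall N, mFourierCoeff (EuclideanSpace.complexify ∘ g) k = 0) :
    ∫ x, ⟪meanFlow N μ x, g x⟫_ℝ = ∫ u, Torus.pairing u.1 g ∂μ := by
  simp_rw [pairing_eq_sum_frameG N _ hg hband]
  rw [integral_finsetSum _ fun i _ =>
    (integrable_pairing ((isBandTest_frameG N i).1.memLp 2) h1).mul_const _]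
  simp_rw [integral_mul_const]
  exact integral_inner_sum_smul_frameG N (meanCoeff N μ) hg

/-- Cauchy–Schwarz for two `L²` fields on the torus. -/
theorem integral_inner_le_sqrt_mul_sqrt {a b : T3 → R3} (ha : MemLp a 2 volume) (hb : MemLp b 2 volume) :
    ∫ x, ⟪a x, b x⟫_ℝ ≤ Real.sqrt (∫ x, ‖a x‖ ^ 2) * Real.sqrt (∫ x, ‖b x‖ ^ 2) := by
  have h : ∫ x, ⟪a x, b x⟫_ℝ = ⟪ha.toLp a, hb.toLp b⟫_ℝ := by
    rw [MeasureTheory.L2.inner_def]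
    refine integral_congr_ae ?_
    filter_upwards [ha.coeFn_toLp, hb.coeFn_toLp] with x hxa hxb
    rw [hxa, hxb]
  rw [h, ← norm_toLp_eq_sqrt ha, ← norm_toLp_eq_sqrt hb]
  exact real_inner_le_norm _ _

/-- **MEAN-FLOW FLOOR**: every witness has `ε ≤ ‖f‖₂ · ‖ū_N‖₂` — a macroscopic level-`N` mean flow. -/
theorem IsWitness.le_meanFlow {f : T3 → R3} (hf : MemLp f 2 volume) {ν : ℝ} {N : ℕ} {E ε : ℝ}
    {μ : Measure H3} (hW : IsWitness f ν N E ε μ) :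
    ε ≤ Real.sqrt (∫ x, ‖f x‖ ^ 2) * Real.sqrt (∫ x, ‖meanFlow N μ x‖ ^ 2) := by
  have hP := hW.1
  have hlev := hW.2.1
  have h1 : Integrable (fun u : H3 => ‖u‖) μ := by
    simpa using integrable_norm_pow_of_cube hW.2.2.1 (p := 1) (by norm_num)
  have hfint : Integrable f volume := hf.integrable one_le_two
  have hPf : MemLp (Torus.fourierTruncate N f) 2 volume := Torus.memLp_fourierTruncate N f 2
  have hPf_band : ∀ k ∉ Torus.freqBall N,
      mFourierCoeff (EuclideanSpace.complexify ∘ Torus.fourierTruncate N f) k = 0 := by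
    intro k hk
    rw [Torus.mFourierCoeff_fourierTruncate hfint, if_neg hk]
  -- on level-N fields, `(u, f) = (u, P_N f)`
  have hswap : ∀ᵐ u ∂μ, Torus.pairing u.1 f = Torus.pairing u.1 (Torus.fourierTruncate N f) := by
    filter_upwards [hlev] with u hu
    have hmem : MemLp ((u : L2T3) : T3 → R3) 2 volume := Lp.memLp _
    have hub : ∀ k ∉ Torus.freqBall N, mFourierCoeff (EuclideanSpace.complexify ∘ ((u : L2T3) : T3 → R3)) k = 0 :=
      fun k hk => hu k (fun h => hk (Finset.mem_of_mem_erase h))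
    have h := Torus.integral_inner_fourierTruncate_eq hf hmem hub
    have e1 : Torus.pairing u.1 f = ∫ x, ⟪f x, ((u : L2T3) : T3 → R3) x⟫_ℝ :=
      integral_congr_ae (ae_of_all _ fun x => real_inner_comm _ _)
    have e2 : Torus.pairing u.1 (Torus.fourierTruncate N f) =
        ∫ x, ⟪Torus.fourierTruncate N f x, ((u : L2T3) : T3 → R3) x⟫_ℝ :=
      integral_congr_ae (ae_of_all _ fun x => real_inner_comm _ _)
    rw [e1, e2]
    exact h.symm
  have hmf : MemLp (meanFlow N μ) 2 volume := (isBandTest_meanFlow N μ).1.memLp 2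
  calc ε ≤ ∫ u, Torus.pairing u.1 f ∂μ := hW.integral_pairing_ge hf
    _ = ∫ u, Torus.pairing u.1 (Torus.fourierTruncate N f) ∂μ := integral_congr_ae hswap
    _ = ∫ x, ⟪meanFlow N μ x, Torus.fourierTruncate N f x⟫_ℝ := (integral_inner_meanFlow h1 hPf hPf_band).symm
    _ ≤ Real.sqrt (∫ x, ‖meanFlow N μ x‖ ^ 2) * Real.sqrt (∫ x, ‖Torus.fourierTruncate N f x‖ ^ 2) :=
        integral_inner_le_sqrt_mul_sqrt hmf hPf
    _ ≤ Real.sqrt (∫ x, ‖meanFlow N μ x‖ ^ 2) * Real.sqrt (∫ x, ‖f x‖ ^ 2) :=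
        mul_le_mul_of_nonneg_left (Real.sqrt_le_sqrt (Torus.integral_norm_sq_fourierTruncate_le hf N))
          (Real.sqrt_nonneg _)
    _ = Real.sqrt (∫ x, ‖f x‖ ^ 2) * Real.sqrt (∫ x, ‖meanFlow N μ x‖ ^ 2) := mul_comm _ _

end MeanFlow


/-! ## §9 LAMINAR CEILING `ε ≤ ‖f‖₂²/(4π²ν)`: the threshold `ν₀` is load-bearing (`ν₀ ≲ ‖f‖₂²/ε`)

Chain: `ε ≤ D := ensembleDissipation = (ū_N, P_N f) ≤ ‖ū_N‖₂ ‖f‖₂` (§8) and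
`‖ū_N‖₂² = ∫ (u, ū_N) dμ ≤ ‖ū_N‖₂ ∫‖u‖dμ`, `(∫‖u‖)² ≤ ∫‖u‖² ≤ (4π²)⁻¹ ∫‖∇u‖² = D/(4π²ν)` (Poincaré on
`H`), whence `D ≤ ‖f‖₂ (D/(4π²ν))^{1/2}`, i.e. the classical laminar bound `D ≤ ‖f‖₂²/(4π²ν)`. So witnesses
exist only for `ν ≤ ‖f‖₂²/(4π²ε)`, and the strengthening of the crux without the viscosity threshold is FALSE. -/

section Laminar

/-- The mean flow is controlled by the mean speed: `‖ū_N‖₂ ≤ ∫ ‖u‖ dμ`. -/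
theorem norm_meanFlow_le {N : ℕ} {μ : Measure H3} [IsFiniteMeasure μ] (h1 : Integrable (fun u : H3 => ‖u‖) μ) :
    Real.sqrt (∫ x, ‖meanFlow N μ x‖ ^ 2) ≤ ∫ u, ‖u‖ ∂μ := by
  have hmf : MemLp (meanFlow N μ) 2 volume := (isBandTest_meanFlow N μ).1.memLp 2
  have hband : ∀ k ∉ Torus.freqBall N, mFourierCoeff (EuclideanSpace.complexify ∘ meanFlow N μ) k = 0 :=
    fun k hk => (isBandTest_meanFlow N μ).2.2.2 k (fun h => hk (Finset.mem_of_mem_erase h))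
  set M : ℝ := Real.sqrt (∫ x, ‖meanFlow N μ x‖ ^ 2) with hM
  have hM0 : 0 ≤ M := Real.sqrt_nonneg _
  -- `M² = (ū, ū) = ∫ (u, ū) dμ ≤ M ∫ ‖u‖ dμ`
  have hsq : M ^ 2 = ∫ x, ⟪meanFlow N μ x, meanFlow N μ x⟫_ℝ := by
    rw [hM, Real.sq_sqrt (integral_nonneg fun _ => by positivity)]
    refine integral_congr_ae (ae_of_all _ fun x => ?_)
    simp only [real_inner_self_eq_norm_sq]
  have hle : M ^ 2 ≤ M * ∫ u, ‖u‖ ∂μ := by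
    rw [hsq, integral_inner_meanFlow h1 hmf hband]
    calc ∫ u, Torus.pairing u.1 (meanFlow N μ) ∂μ ≤ ∫ u, ‖u‖ * ‖hmf.toLp (meanFlow N μ)‖ ∂μ :=
          integral_mono (integrable_pairing hmf h1) (h1.mul_const _) fun u =>
            (le_abs_self _).trans (Torus.abs_pairing_coe_le hmf u)
      _ = M * ∫ u, ‖u‖ ∂μ := by rw [integral_mul_const, norm_toLp_eq_sqrt, mul_comm]
  by_cases hMz : M = 0
  · rw [hMz]; exact integral_nonneg fun _ => norm_nonneg _
  · have hMpos : 0 < M := lt_of_le_of_ne hM0 (Ne.symm hMz)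
    nlinarith

/-- **POINCARÉ IN THE MEAN**: `4π² · ensembleEnergy μ ≤ ensembleDissipation ν μ / ν` for a law with finite
mean enstrophy and integrable energy (`ν > 0`). -/
theorem ensembleEnergy_le_dissipation {μ : Measure H3} (hfin : Torus.ensembleEnstrophy μ ≠ ⊤)
    (h2 : Integrable (fun u : H3 => ‖u‖ ^ 2) μ) {ν : ℝ} (hν : 0 < ν) :
    4 * Real.pi ^ 2 * Torus.ensembleEnergy μ ≤ Torus.ensembleDissipation ν μ / ν := by
  have hpt : ∀ u : H3, ENNReal.ofReal (4 * Real.pi ^ 2 * ‖u‖ ^ 2) ≤ Torus.eGradNormSq ((u : L2T3) : T3 → R3) := by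
    intro u
    have h := Torus.ofReal_integral_norm_sq_le_eGradNormSq u.2
    rwa [Torus.integral_norm_sq_coe_eq, ← ENNReal.ofReal_mul (by positivity)] at h
  have hlin : ∫⁻ u, ENNReal.ofReal (4 * Real.pi ^ 2 * ‖u‖ ^ 2) ∂μ ≤ Torus.ensembleEnstrophy μ :=
    lintegral_mono hpt
  have hofReal : ∫⁻ u, ENNReal.ofReal (4 * Real.pi ^ 2 * ‖u‖ ^ 2) ∂μ =
      ENNReal.ofReal (4 * Real.pi ^ 2 * Torus.ensembleEnergy μ) := by
    rw [Torus.ensembleEnergy, ← integral_const_mul]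
    exact (ofReal_integral_eq_lintegral_ofReal (h2.const_mul _) (ae_of_all _ fun u => by positivity)).symm
  have hE0 : 0 ≤ 4 * Real.pi ^ 2 * Torus.ensembleEnergy μ :=
    mul_nonneg (by positivity) (integral_nonneg fun _ => by positivity)
  have h := ENNReal.toReal_mono hfin (hofReal ▸ hlin)
  rw [ENNReal.toReal_ofReal hE0] at h
  rw [Torus.ensembleDissipation, mul_div_assoc, mul_div_assoc', mul_div_cancel_left₀ _ hν.ne']
  exact h

/-- **LAMINAR CEILING FOR WITNESSES**: `ε ≤ ‖f‖₂² / (4π²ν)`. Hence witnesses of the crux exist only for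
`ν ≤ ‖f‖₂²/(4π²ε)`: the viscosity threshold `ν₀` is load-bearing. -/
theorem IsWitness.laminar {f : T3 → R3} (hf : MemLp f 2 volume) {ν : ℝ} (hν : 0 < ν) {N : ℕ} {E ε : ℝ}
    (hε : 0 < ε) {μ : Measure H3} (hW : IsWitness f ν N E ε μ) :
    ε ≤ (∫ x, ‖f x‖ ^ 2) / (4 * Real.pi ^ 2 * ν) := by
  have hP := hW.1
  have h1 : Integrable (fun u : H3 => ‖u‖) μ := by
    simpa using integrable_norm_pow_of_cube hW.2.2.1 (p := 1) (by norm_num)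
  have h2 : Integrable (fun u : H3 => ‖u‖ ^ 2) μ := integrable_norm_pow_of_cube hW.2.2.1 (p := 2) (by norm_num)
  set D : ℝ := Torus.ensembleDissipation ν μ with hD
  set A : ℝ := Real.sqrt (∫ x, ‖f x‖ ^ 2) with hA
  have hA0 : 0 ≤ A := Real.sqrt_nonneg _
  have hεD : ε ≤ D := hW.2.2.2.2.2
  -- `D ≤ A ‖ū‖ ≤ A ∫‖u‖ ≤ A √energy ≤ A √(D/(4π²ν))`
  have hstep1 : D ≤ A * Real.sqrt (∫ x, ‖meanFlow N μ x‖ ^ 2) := by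
    rw [hD, hW.dissipation_eq hf]
    have := hW.le_meanFlow hf
    -- re-run the §8 chain with `∫(u,f)` in place of `ε`
    have hlev := hW.2.1
    have hfint : Integrable f volume := hf.integrable one_le_two
    have hPf : MemLp (Torus.fourierTruncate N f) 2 volume := Torus.memLp_fourierTruncate N f 2
    have hPf_band : ∀ k ∉ Torus.freqBall N,
        mFourierCoeff (EuclideanSpace.complexify ∘ Torus.fourierTruncate N f) k = 0 := by
      intro k hk; rw [Torus.mFourierCoeff_fourierTruncate hfint, if_neg hk]
    have hswap : ∀ᵐ u ∂μ, Torus.pairing u.1 f = Torus.pairing u.1 (Torus.fourierTruncate N f) := by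
      filter_upwards [hlev] with u hu
      have hmem : MemLp ((u : L2T3) : T3 → R3) 2 volume := Lp.memLp _
      have hub : ∀ k ∉ Torus.freqBall N, mFourierCoeff (EuclideanSpace.complexify ∘ ((u : L2T3) : T3 → R3)) k = 0 :=
        fun k hk => hu k (fun h => hk (Finset.mem_of_mem_erase h))
      have h := Torus.integral_inner_fourierTruncate_eq hf hmem hub
      have e1 : Torus.pairing u.1 f = ∫ x, ⟪f x, ((u : L2T3) : T3 → R3) x⟫_ℝ :=
        integral_congr_ae (ae_of_all _ fun x => real_inner_comm _ _)
      have e2 : Torus.pairing u.1 (Torus.fourierTruncate N f) =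
          ∫ x, ⟪Torus.fourierTruncate N f x, ((u : L2T3) : T3 → R3) x⟫_ℝ :=
        integral_congr_ae (ae_of_all _ fun x => real_inner_comm _ _)
      rw [e1, e2]; exact h.symm
    have hmf : MemLp (meanFlow N μ) 2 volume := (isBandTest_meanFlow N μ).1.memLp 2
    calc ∫ u, Torus.pairing u.1 f ∂μ = ∫ u, Torus.pairing u.1 (Torus.fourierTruncate N f) ∂μ :=
          integral_congr_ae hswap
      _ = ∫ x, ⟪meanFlow N μ x, Torus.fourierTruncate N f x⟫_ℝ := (integral_inner_meanFlow h1 hPf hPf_band).symm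
      _ ≤ Real.sqrt (∫ x, ‖meanFlow N μ x‖ ^ 2) * Real.sqrt (∫ x, ‖Torus.fourierTruncate N f x‖ ^ 2) :=
          integral_inner_le_sqrt_mul_sqrt hmf hPf
      _ ≤ Real.sqrt (∫ x, ‖meanFlow N μ x‖ ^ 2) * A :=
          mul_le_mul_of_nonneg_left (Real.sqrt_le_sqrt (Torus.integral_norm_sq_fourierTruncate_le hf N))
            (Real.sqrt_nonneg _)
      _ = A * Real.sqrt (∫ x, ‖meanFlow N μ x‖ ^ 2) := mul_comm _ _
  have hstep2 : Real.sqrt (∫ x, ‖meanFlow N μ x‖ ^ 2) ≤ Real.sqrt (Torus.ensembleEnergy μ) :=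
    (norm_meanFlow_le h1).trans ((le_abs_self _).trans (Real.abs_le_sqrt (sq_integral_norm_le h2)))
  have hfin : Torus.ensembleEnstrophy μ ≠ ⊤ := hW.ensembleEnstrophy_ne_top hε
  have hstep3 : 4 * Real.pi ^ 2 * Torus.ensembleEnergy μ ≤ D / ν := ensembleEnergy_le_dissipation hfin h2 hν
  have hc : 0 < 4 * Real.pi ^ 2 * ν := by positivity
  have hD0 : 0 ≤ D := hε.le.trans hεD
  -- square the chain: `D² ≤ A² · energy ≤ A² D/(4π²ν)`
  have hchain : D ≤ A * Real.sqrt (Torus.ensembleEnergy μ) :=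
    hstep1.trans (mul_le_mul_of_nonneg_left hstep2 hA0)
  have hEn : 0 ≤ Torus.ensembleEnergy μ := integral_nonneg fun _ => by positivity
  have hsq : D ^ 2 ≤ A ^ 2 * Torus.ensembleEnergy μ := by
    calc D ^ 2 ≤ (A * Real.sqrt (Torus.ensembleEnergy μ)) ^ 2 := pow_le_pow_left₀ hD0 hchain 2
      _ = A ^ 2 * Torus.ensembleEnergy μ := by rw [mul_pow, Real.sq_sqrt hEn]
  have hsq2 : D ^ 2 ≤ A ^ 2 * (D / (4 * Real.pi ^ 2 * ν)) := by
    have : Torus.ensembleEnergy μ ≤ D / (4 * Real.pi ^ 2 * ν) := by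
      rw [le_div_iff₀ hc]
      calc Torus.ensembleEnergy μ * (4 * Real.pi ^ 2 * ν) = (4 * Real.pi ^ 2 * Torus.ensembleEnergy μ) * ν := by ring
        _ ≤ (D / ν) * ν := mul_le_mul_of_nonneg_right hstep3 hν.le
        _ = D := div_mul_cancel₀ _ hν.ne'
    exact hsq.trans (mul_le_mul_of_nonneg_left this (sq_nonneg _))
  have hA2 : A ^ 2 = ∫ x, ‖f x‖ ^ 2 := Real.sq_sqrt (integral_nonneg fun _ => by positivity)
  -- conclude `D ≤ A²/(4π²ν)`
  have hDle : D ≤ A ^ 2 / (4 * Real.pi ^ 2 * ν) := by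
    by_cases hDz : D = 0
    · rw [hDz]; positivity
    · have hDpos : 0 < D := lt_of_le_of_ne hD0 (Ne.symm hDz)
      rw [le_div_iff₀ hc]
      have h' : D ^ 2 * (4 * Real.pi ^ 2 * ν) ≤ A ^ 2 * D := by
        have hx : A ^ 2 * (D / (4 * Real.pi ^ 2 * ν)) * (4 * Real.pi ^ 2 * ν) = A ^ 2 * D := by
          field_simp
        calc D ^ 2 * (4 * Real.pi ^ 2 * ν) ≤ A ^ 2 * (D / (4 * Real.pi ^ 2 * ν)) * (4 * Real.pi ^ 2 * ν) :=
              mul_le_mul_of_nonneg_right hsq2 hc.le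
          _ = A ^ 2 * D := hx
      nlinarith
  rw [← hA2]
  exact hεD.trans hDle

/-- STRENGTHENING (refuted): the crux WITHOUT the viscosity threshold `ν < ν₀` (all `ν > 0`). -/
def CubicParityLoudAllViscosities : Prop :=
  ∀ f : T3 → R3, Torus.IsSmooth f → Torus.IsDivFree f → Torus.HasZeroMean f → f ≠ 0 →
    ∃ E ε : ℝ, 0 < ε ∧ ∀ ν : ℝ, 0 < ν → ∃ N₀ : ℕ, ∀ N : ℕ, N₀ ≤ N → ∃ μ : Measure H3, IsWitness f ν N E ε μ

/-- `ν₀` is load-bearing: at `ν = (‖f‖₂² + 1)/(2π²ε)` the laminar ceiling leaves `< ε`. -/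
theorem not_cubicParityLoudAllViscosities : ¬ CubicParityLoudAllViscosities := by
  intro h
  obtain ⟨E, ε, hε, h⟩ := h shearForce isSmooth_shearForce isDivFree_shearForce hasZeroMean_shearForce
    shearForce_ne_zero
  set A2 : ℝ := ∫ x, ‖shearForce x‖ ^ 2 with hA2
  have hA0 : 0 ≤ A2 := integral_nonneg fun _ => by positivity
  set ν : ℝ := (A2 + 1) / (2 * Real.pi ^ 2 * ε) with hν
  have hνpos : 0 < ν := by positivity
  obtain ⟨N₀, hN⟩ := h ν hνpos
  obtain ⟨μ, hW⟩ := hN N₀ le_rfl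
  have hlam := hW.laminar (memLp_of_isSmooth isSmooth_shearForce) hνpos hε
  rw [← hA2] at hlam
  have hden : 0 < 4 * Real.pi ^ 2 * ν := by positivity
  have key : A2 / (4 * Real.pi ^ 2 * ν) < ε := by
    rw [div_lt_iff₀ hden, hν]
    have : ε * (4 * Real.pi ^ 2 * ((A2 + 1) / (2 * Real.pi ^ 2 * ε))) = 2 * (A2 + 1) := by
      field_simp; ring
    rw [this]; linarith
  linarith

end Laminar


/-! ## §10 SMALL-MODEL NUMBERS (kit job j008815, evidence `compute-j008815.json` on the item; script
`casimir/main.py` of this seat): the two all-`N` algebraic inputs of the mechanism hold at every freqBall level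
`N = 2 … 6` — no small-model kill.

(i) QUADRATIC CASIMIRS of the ball-truncated Galerkin–Euler system `B_N`, over ALL quadratic forms on `V_N`
(complexified, block-diagonalised by momentum sector `P = k + k'`; unknowns = all symmetric `Q_{κλ}`; equations
= vanishing of the symmetrised cubic `Sym Σ_μ Q_{κμ} B^μ_{αβ}`; nullity of `AᴴA` per sector at relative
tolerance `1e-9`):

| level `N` | wavevectors | `dim V_N` | sectors | TOTAL nullity (all forms) | where | 3rd rel. eigenvalue in sector 0 | min rel. eigenvalue, other sectors |
|---|---|---|---|---|---|---|---|
| 2 | 32 | 64 | 185 | **2** | sector `P = 0` | 0.191 | 0.227 |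
| 3 | 122 | 244 | 829 | **2** | sector `P = 0` | 0.274 | 0.165 |
| 4 | 256 | 512 | 1797 | **2** | sector `P = 0` | 0.195 | 0.108 |
| 5 | 514 | 1028 | 3809 | **2** | sector `P = 0` | 0.133 | 0.071 |
| 6 | 924 | 1848 | 6865 | **2** | sector `P = 0` | 0.094 | 0.050 |

The two kernel vectors are energy and helicity (both verified conserved to `1e-17` relative at random complex
states). So `QuadRigidity(N)` — "quadratic Casimirs of `B_N` = span{E, H}" — holds for ALL (not only
translation-invariant) forms at levels 2–6 with an `N`-uniform-looking spectral gap; previously it was known for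
all forms only on the 26-mode cube and for Fourier-diagonal forms up to 728 modes (card jobs j002303/j002348/
j002350, refuter j003345/j003422). (Level 1 is degenerate: `B_1 ≡ 0`.)

(ii) STRESS SPAN: for every wavevector `q` of the ball, the symmetric stress images `B_N(v,w) + B_N(w,v)` fill the
2-dimensional solenoidal plane at `q` (rank 2 at every `q`; worst relative second singular value 0.946, 0.894,
0.975, 0.962, 0.954 for `N = 2…6`; no unreachable `q`) ⇒ span = `V_N`, and since `Σ_a B_N(e_a,e_a) = 0` over any
orthonormal basis the PSD-generated cone is that whole space: every mean Reynolds-stress divergence is realisable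
by a covariance at levels 2–6.

(iii) The explicit order-≤2 design for random multi-mode forces (least-norm PSD-completed stress for the linear
rows, helical shell sea for the energy/helicity rows, `T`-solve of the quadratic rows at `N = 2`) is rerun as
kit job j014394 (the first run stopped on an over-strict per-term reality assertion in the real-basis tensor
assembly — a script bug, not a finding); its summary attaches to the item automatically.

UPSHOT for the disproof: the only remaining kill routes (an accidental coercive quadratic Casimir, or a defect of
the stress span, at infinitely many levels) have no trace up to level 6 / 1848 real dimensions; together with the
per-triad helical computation (diagonal forms: `α, β` constant on every triad ⇒ `Q = αE + βH` by triad
connectivity) the negative side regards `CubicParityLoud` as TRUE-but-unproved, and its formal content for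
constructions is §1–§9. -/

/-! ## §11 FLUX FLOOR (gen 2, cycle 1; LANDED as `Theorems/CubicParityLoud/Negative/FluxFloor.lean`, p85490):
the cubic moments of a witness carry the energy flux `≈ ε` through every wavenumber between the force scale and
the Taylor scale — "order 3 is free" but ORDER 3 IS NOT ZERO

The LOW-PASS ENERGY ROW at level `K ≤ N` (test `p_K(u) = Σ_{e ∈ frame(K)} (u,e)²`, admissible since
`freqBall K ⊆ freqBall N`; differential `2P_K u`) reads pointwise `⟨F_ν(u), 2P_K u⟩ = 2((u,P_K f) − ν‖∇P_K u‖² − Π_K(u))`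
with the ENERGY FLUX `Π_K(u) := −∫(u⊗u):∇(P_K u) = ((u·∇)u, P_K u)` (cubic, odd in `u`). Integrated against a witness:
FLUX IDENTITY `∫Π_K dμ = ∫(u,P_K f)dμ − ν∫‖∇P_K u‖²dμ` and FLUX FLOOR `∫Π_K dμ ≥ ε − ‖f − P_K f‖₂√E − 4π²K²νE`.
So at every `K` past the force scale and below the Taylor scale the third moments of a witness are charged with a
forward cascade `≥ ε/3` — uniformly over `K_f ≲ K ≪ ν^{-1/2}` (the inviscid 4/5-law skeleton at Galerkin level).
NO-GO it implies (prose, by a four-line moment computation): a law `u = m + v` with band-limited mean flow `m`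
(level `K_m`), fluctuations `v` with vanishing odd moments (e.g. sign-symmetric atom clouds, Gaussian seas) and
stress-carrying correlations `E[v̂(a) ⊗ v̂(b)^*]`, `a ≠ b`, confined to `|a|,|b| ≤ K_*` has, for `K ≥ max(K_m, K_*)`,
`∫Π_K dμ = −C:∇m + E[((m·∇)v, P_K v)] + E[((v·∇)m, P_K v)] = −C:∇m + 0 + C:∇m = 0` — so NO SUCH LAW IS A WITNESS
once `‖f − P_K f‖₂√E + 4π²K²νE < ε` for one such `K ≤ N` (all small `ν`, all large `N`). This is exactly the shape of
the S5 menu laws (mean mode + four-phase packets at `|k|² ≤ 2`, shift `q` + sign-symmetric sea): they are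
1-stationary by design and can never be 3-stationary; the Farkas witness (Carathéodory atoms) / the blueprint's
designed third cumulant `T` must transport `≈ ε` through EVERY inertial `K`, by triads reaching the Taylor shell. -/

section FluxFloor

/-- Band tests of level `K` are band tests of every level `N ≥ K`. -/
theorem IsBandTest.mono {K N : ℕ} (h : K ≤ N) {g : T3 → R3} (hg : IsBandTest K g) : IsBandTest N g := by
  refine ⟨hg.1, hg.2.1, hg.2.2.1, fun k hk => hg.2.2.2 k fun hk' => hk ?_⟩
  exact Finset.mem_erase.2 ⟨(Finset.mem_erase.1 hk').1, Torus.freqBall_mono h (Finset.mem_erase.1 hk').2⟩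

/-- The LOW-PASS ENSTROPHY `‖∇P_K u‖²` of `u ∈ H` as a finite Fourier sum: `4π² Σ_{|k| ≤ K} |k|² ‖û(k)‖²`. -/
theorem lowEnstrophy_eq_sum (K : ℕ) (u : H3) :
    (Torus.eGradNormSq (Torus.fourierTruncate K ((u : L2T3) : T3 → R3))).toReal = 4 * Real.pi ^ 2 * ∑ k ∈ Torus.freqBall K,
      Torus.freqNormSq k * ‖mFourierCoeff (EuclideanSpace.complexify ∘ ((u : L2T3) : T3 → R3)) k‖ ^ 2 := by
  have hint : Integrable ((u : L2T3) : T3 → R3) volume := (Lp.memLp (u : L2T3)).integrable one_le_two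
  rw [Torus.fourierTruncate_eq,
    Torus.toReal_eGradNormSq_realTrigPoly Torus.neg_mem_freqBall_of_mem (Torus.isConjSymm_mFourierCoeff hint)]

/-- The low-pass enstrophy is continuous on `H` (a finite sum of continuous Fourier coefficients). -/
theorem continuous_lowEnstrophy (K : ℕ) :
    Continuous fun u : H3 => (Torus.eGradNormSq (Torus.fourierTruncate K ((u : L2T3) : T3 → R3))).toReal := by
  have h : (fun u : H3 => (Torus.eGradNormSq (Torus.fourierTruncate K ((u : L2T3) : T3 → R3))).toReal) = fun u : H3 => 4 * Real.pi ^ 2 * ∑ k ∈ Torus.freqBall K,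
      Torus.freqNormSq k * ‖mFourierCoeff (EuclideanSpace.complexify ∘ ((u : L2T3) : T3 → R3)) k‖ ^ 2 :=
    funext (lowEnstrophy_eq_sum K)
  rw [h]
  refine continuous_const.mul (continuous_finsetSum _ fun k _ => continuous_const.mul ?_)
  exact ((Torus.continuous_mFourierCoeff_complexify_coe k).comp continuous_subtype_val).norm.pow 2

/-- `0 ≤ ‖∇P_K u‖²`. -/
theorem lowEnstrophy_nonneg (K : ℕ) (u : H3) : 0 ≤ (Torus.eGradNormSq (Torus.fourierTruncate K ((u : L2T3) : T3 → R3))).toReal := ENNReal.toReal_nonneg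

/-- **Bernstein at level `K`**: `‖∇P_K u‖² ≤ 4π²K²‖u‖²` for every `u ∈ H`. -/
theorem lowEnstrophy_le (K : ℕ) (u : H3) : (Torus.eGradNormSq (Torus.fourierTruncate K ((u : L2T3) : T3 → R3))).toReal ≤ 4 * Real.pi ^ 2 * (K : ℝ) ^ 2 * ‖u‖ ^ 2 := by
  have hmem : MemLp ((u : L2T3) : T3 → R3) 2 volume := Lp.memLp (u : L2T3)
  have hint : Integrable ((u : L2T3) : T3 → R3) volume := hmem.integrable one_le_two
  rw [lowEnstrophy_eq_sum]
  have h1 : ∑ k ∈ Torus.freqBall K, Torus.freqNormSq k *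
      ‖mFourierCoeff (EuclideanSpace.complexify ∘ ((u : L2T3) : T3 → R3)) k‖ ^ 2 ≤
      (K : ℝ) ^ 2 * ∑ k ∈ Torus.freqBall K, ‖mFourierCoeff (EuclideanSpace.complexify ∘ ((u : L2T3) : T3 → R3)) k‖ ^ 2 := by
    rw [Finset.mul_sum]
    exact Finset.sum_le_sum fun k hk => mul_le_mul_of_nonneg_right (Torus.mem_freqBall.1 hk) (sq_nonneg _)
  have h2 : ∑ k ∈ Torus.freqBall K, ‖mFourierCoeff (EuclideanSpace.complexify ∘ ((u : L2T3) : T3 → R3)) k‖ ^ 2 ≤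
      ‖u‖ ^ 2 := by
    have h := Torus.integral_norm_sq_fourierTruncate_le hmem K
    rw [Torus.integral_norm_sq_fourierTruncate hint, Torus.integral_norm_sq_coe_eq] at h
    exact h
  calc 4 * Real.pi ^ 2 * ∑ k ∈ Torus.freqBall K, Torus.freqNormSq k *
        ‖mFourierCoeff (EuclideanSpace.complexify ∘ ((u : L2T3) : T3 → R3)) k‖ ^ 2
      ≤ 4 * Real.pi ^ 2 * ((K : ℝ) ^ 2 * ‖u‖ ^ 2) := by
        refine mul_le_mul_of_nonneg_left (h1.trans ?_) (by positivity)
        exact mul_le_mul_of_nonneg_left h2 (sq_nonneg _)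
    _ = 4 * Real.pi ^ 2 * (K : ℝ) ^ 2 * ‖u‖ ^ 2 := by ring

/-- The force term of the low-pass energy row is the pairing with the truncated force:
`∫ ⟪f, P_K u⟫ = (u, P_K f)`. -/
theorem integral_inner_fourierTruncate_coe {f : T3 → R3} (hf : MemLp f 2 volume) (K : ℕ) (u : H3) :
    (∫ x, ⟪f x, Torus.fourierTruncate K ((u : L2T3) : T3 → R3) x⟫_ℝ) =
      Torus.pairing u.1 (Torus.fourierTruncate K f) := by
  have hmem : MemLp ((u : L2T3) : T3 → R3) 2 volume := Lp.memLp (u : L2T3)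
  have hint : Integrable ((u : L2T3) : T3 → R3) volume := hmem.integrable one_le_two
  have hfint : Integrable f volume := hf.integrable one_le_two
  calc (∫ x, ⟪f x, Torus.fourierTruncate K ((u : L2T3) : T3 → R3) x⟫_ℝ)
      = ∫ x, ⟪Torus.fourierTruncate K ((u : L2T3) : T3 → R3) x, f x⟫_ℝ :=
        integral_congr_ae (ae_of_all _ fun x => real_inner_comm _ _)
    _ = ∑ k ∈ Torus.freqBall K, (inner ℂ (mFourierCoeff (EuclideanSpace.complexify ∘ ((u : L2T3) : T3 → R3)) k)
          (mFourierCoeff (EuclideanSpace.complexify ∘ f) k)).re :=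
        Torus.integral_inner_fourierTruncate_left hint hf K
    _ = ∑ k ∈ Torus.freqBall K, (inner ℂ (mFourierCoeff (EuclideanSpace.complexify ∘ f) k)
          (mFourierCoeff (EuclideanSpace.complexify ∘ ((u : L2T3) : T3 → R3)) k)).re :=
        Finset.sum_congr rfl fun k _ => by rw [← inner_conj_symm, Complex.conj_re]
    _ = ∫ x, ⟪Torus.fourierTruncate K f x, ((u : L2T3) : T3 → R3) x⟫_ℝ :=
        (Torus.integral_inner_fourierTruncate_left hfint hmem K).symm
    _ = Torus.pairing u.1 (Torus.fourierTruncate K f) := by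
        rw [Torus.pairing]
        exact integral_congr_ae (ae_of_all _ fun x => real_inner_comm _ _)

/-- **The low-pass energy row, pointwise**: for every `u ∈ H`,
`⟨F_ν(u), ∇p_K(u)⟩ = 2 ((u, P_K f) − ν‖∇P_K u‖² − Π_K(u))` with the ENERGY FLUX
`Π_K(u) := −∫ (u⊗u) : ∇(P_K u)` (`= ((u·∇)u, P_K u)` for smooth `u`; cubic in `u`). -/
theorem nsGeneratorPairing_energy_eq_flux (ν : ℝ) {f : T3 → R3} (hf : MemLp f 2 volume) (K : ℕ) (u : H3) :
    Torus.nsGeneratorPairing ν f u (polyGrad (frameG K) (energyPoly _) u) =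
      2 * (Torus.pairing u.1 (Torus.fourierTruncate K f) - ν * (Torus.eGradNormSq (Torus.fourierTruncate K ((u : L2T3) : T3 → R3))).toReal -
        (-Torus.inertialPairing (u : L2T3) (Torus.fourierTruncate K ((u : L2T3) : T3 → R3)))) := by
  rw [nsGeneratorPairing_energy, integral_inner_fourierTruncate_coe hf]
  ring

/-- **FLUX IDENTITY.** For a witness at level `N` and any `K ≤ N`: the flux `Π_K` is `μ`-integrable
and `∫ Π_K dμ = ∫ (u, P_K f) dμ − ν ∫ ‖∇P_K u‖² dμ` (the low-pass energy row, integrated). -/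
theorem IsWitness.integral_flux_eq {f : T3 → R3} (hf : MemLp f 2 volume) {ν : ℝ} {N : ℕ} {E ε : ℝ}
    {μ : Measure H3} (hW : IsWitness f ν N E ε μ) {K : ℕ} (hK : K ≤ N) :
    Integrable (fun u : H3 => (-Torus.inertialPairing (u : L2T3) (Torus.fourierTruncate K ((u : L2T3) : T3 → R3)))) μ ∧
      ∫ u, (-Torus.inertialPairing (u : L2T3) (Torus.fourierTruncate K ((u : L2T3) : T3 → R3))) ∂μ =
        (∫ u, Torus.pairing u.1 (Torus.fourierTruncate K f) ∂μ) -
          ν * ∫ u, (Torus.eGradNormSq (Torus.fourierTruncate K ((u : L2T3) : T3 → R3))).toReal ∂μ := by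
  obtain ⟨hP, -, h3, hstat, -, -⟩ := hW
  have h1 : Integrable (fun u : H3 => ‖u‖) μ := by
    simpa using integrable_norm_pow_of_cube h3 (p := 1) (by norm_num)
  have h2 : Integrable (fun u : H3 => ‖u‖ ^ 2) μ := integrable_norm_pow_of_cube h3 (p := 2) (by norm_num)
  obtain ⟨hI, h0⟩ := hstat _ (frameG K) (energyPoly _) (fun i => (isBandTest_frameG K i).mono hK)
    (totalDegree_energyPoly _)
  set G : H3 → ℝ := fun u => Torus.nsGeneratorPairing ν f u (polyGrad (frameG K) (energyPoly _) u) with hG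
  set A : H3 → ℝ := fun u => Torus.pairing u.1 (Torus.fourierTruncate K f) with hA
  set L : H3 → ℝ := fun u => (Torus.eGradNormSq (Torus.fourierTruncate K ((u : L2T3) : T3 → R3))).toReal with hL
  set Φ : H3 → ℝ := fun u => (-Torus.inertialPairing (u : L2T3) (Torus.fourierTruncate K ((u : L2T3) : T3 → R3))) with hΦ
  have hGeq : ∀ u, G u = 2 * (A u - ν * L u - Φ u) := fun u =>
    nsGeneratorPairing_energy_eq_flux ν hf K u
  have hAint : Integrable A μ := integrable_pairing (Torus.memLp_fourierTruncate K f 2) h1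
  have hLint : Integrable L μ := by
    refine Integrable.mono' (h2.const_mul (4 * Real.pi ^ 2 * (K : ℝ) ^ 2))
      (continuous_lowEnstrophy K).aestronglyMeasurable (ae_of_all _ fun u => ?_)
    rw [Real.norm_eq_abs, abs_of_nonneg (lowEnstrophy_nonneg K u)]
    exact lowEnstrophy_le K u
  have hFeq : ∀ u, Φ u = (A u - ν * L u) - 2⁻¹ * G u := by
    intro u; rw [hGeq u]; ring
  have hI1 : Integrable (fun u => A u - ν * L u) μ := hAint.sub (hLint.const_mul ν)
  have hI2 : Integrable (fun u => 2⁻¹ * G u) μ := hI.const_mul _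
  have hFint : Integrable Φ μ :=
    (hI1.sub hI2).congr (ae_of_all _ fun u => (hFeq u).symm)
  refine ⟨hFint, ?_⟩
  rw [integral_congr_ae (ae_of_all μ hFeq), integral_sub hI1 hI2, integral_sub hAint (hLint.const_mul ν),
    integral_const_mul, integral_const_mul, h0, mul_zero, sub_zero]

/-- The pairing is additive in the field (both pairings honest for continuous fields). -/
theorem pairing_sub_field (u : H3) {a b : T3 → R3} (ha : Continuous a) (hb : Continuous b) :
    Torus.pairing u.1 (a - b) = Torus.pairing u.1 a - Torus.pairing u.1 b := by
  have hint : Integrable ((u : L2T3) : T3 → R3) volume := (Lp.memLp (u : L2T3)).integrable one_le_two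
  have hia : Integrable (fun x => ⟪((u : L2T3) : T3 → R3) x, a x⟫_ℝ) volume :=
    Torus.integrable_inner_of_continuous hint ha
  have hib : Integrable (fun x => ⟪((u : L2T3) : T3 → R3) x, b x⟫_ℝ) volume :=
    Torus.integrable_inner_of_continuous hint hb
  rw [Torus.pairing, Torus.pairing, Torus.pairing, ← integral_sub hia hib]
  refine integral_congr_ae (ae_of_all _ fun x => ?_)
  change ⟪_, a x - b x⟫_ℝ = _
  rw [inner_sub_right]

/-- **FLUX FLOOR.** Every witness of the crux at `(f, ν, N, E, ε)` (`ν ≥ 0`) drives, through every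
wavenumber `K ≤ N`, a mean energy flux
`∫ Π_K dμ ≥ ε − ‖f − P_K f‖₂ √E − 4π²K²ν E`.
For `K` beyond the force scale (`‖f − P_K f‖₂√E ≤ ε/3`) and below the Taylor scale (`4π²K²νE ≤ ε/3`)
the cubic moments of the witness carry at least `ε/3`: the third-order statistics are NOT free to vanish. -/
theorem IsWitness.flux_floor {f : T3 → R3} (hfs : Torus.IsSmooth f) {ν : ℝ} (hν : 0 ≤ ν) {N : ℕ} {E ε : ℝ}
    {μ : Measure H3} (hW : IsWitness f ν N E ε μ) {K : ℕ} (hK : K ≤ N) :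
    ε - Real.sqrt (∫ x, ‖f x - Torus.fourierTruncate K f x‖ ^ 2) * Real.sqrt E -
        4 * Real.pi ^ 2 * (K : ℝ) ^ 2 * ν * E ≤
      ∫ u, (-Torus.inertialPairing (u : L2T3) (Torus.fourierTruncate K ((u : L2T3) : T3 → R3))) ∂μ := by
  have hf : MemLp f 2 volume := hfs.memLp 2
  have hP := hW.1
  have h3 := hW.2.2.1
  have hE : Torus.ensembleEnergy μ ≤ E := hW.2.2.2.2.1
  have h1 : Integrable (fun u : H3 => ‖u‖) μ := by
    simpa using integrable_norm_pow_of_cube h3 (p := 1) (by norm_num)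
  have h2 : Integrable (fun u : H3 => ‖u‖ ^ 2) μ := integrable_norm_pow_of_cube h3 (p := 2) (by norm_num)
  obtain ⟨-, hid⟩ := hW.integral_flux_eq hf hK
  have hPf : MemLp (Torus.fourierTruncate K f) 2 volume := Torus.memLp_fourierTruncate K f 2
  have htail : MemLp (f - Torus.fourierTruncate K f) 2 volume := hf.sub hPf
  set T : ℝ := Real.sqrt (∫ x, ‖f x - Torus.fourierTruncate K f x‖ ^ 2) with hT
  -- (1) the truncated power: `∫ (u, P_K f) ≥ ∫ (u, f) − T ∫‖u‖ ≥ ε − T √E`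
  have hsplit : ∀ u : H3, Torus.pairing u.1 (Torus.fourierTruncate K f) =
      Torus.pairing u.1 f - Torus.pairing u.1 (f - Torus.fourierTruncate K f) := by
    intro u
    have := pairing_sub_field u hfs.continuous (hfs.continuous.sub (Torus.continuous_fourierTruncate K f))
    rw [show f - (f - Torus.fourierTruncate K f) = Torus.fourierTruncate K f from sub_sub_cancel _ _] at this
    linarith [this]
  have hpow : ε - T * Real.sqrt E ≤ ∫ u, Torus.pairing u.1 (Torus.fourierTruncate K f) ∂μ := by
    have hge := hW.integral_pairing_ge hf
    have hTint : Integrable (fun u : H3 => Torus.pairing u.1 (f - Torus.fourierTruncate K f)) μ :=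
      integrable_pairing htail h1
    have hbound : ∫ u, Torus.pairing u.1 (f - Torus.fourierTruncate K f) ∂μ ≤ T * Real.sqrt E := by
      calc ∫ u, Torus.pairing u.1 (f - Torus.fourierTruncate K f) ∂μ
          ≤ ∫ u, ‖u‖ * ‖htail.toLp (f - Torus.fourierTruncate K f)‖ ∂μ :=
            integral_mono hTint (h1.mul_const _) fun u =>
              (le_abs_self _).trans (Torus.abs_pairing_coe_le htail u)
        _ = (∫ u, ‖u‖ ∂μ) * T := by
            rw [integral_mul_const, norm_toLp_eq_sqrt htail]
            rfl
        _ ≤ Real.sqrt E * T := by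
            refine mul_le_mul_of_nonneg_right ?_ (Real.sqrt_nonneg _)
            exact ((le_abs_self _).trans (Real.abs_le_sqrt (sq_integral_norm_le h2))).trans
              (Real.sqrt_le_sqrt hE)
        _ = T * Real.sqrt E := mul_comm _ _
    have heq : ∫ u, Torus.pairing u.1 (Torus.fourierTruncate K f) ∂μ =
        (∫ u, Torus.pairing u.1 f ∂μ) - ∫ u, Torus.pairing u.1 (f - Torus.fourierTruncate K f) ∂μ := by
      rw [← integral_sub (integrable_pairing hf h1) hTint]
      exact integral_congr_ae (ae_of_all _ fun u => hsplit u)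
    rw [heq]
    linarith
  -- (2) the low-pass dissipation: `ν ∫ ‖∇P_K u‖² ≤ 4π²K²ν E`
  have hdis : ν * ∫ u, (Torus.eGradNormSq (Torus.fourierTruncate K ((u : L2T3) : T3 → R3))).toReal ∂μ ≤
      4 * Real.pi ^ 2 * (K : ℝ) ^ 2 * ν * E := by
    have hle : ∫ u, (Torus.eGradNormSq (Torus.fourierTruncate K ((u : L2T3) : T3 → R3))).toReal ∂μ ≤
        ∫ u, 4 * Real.pi ^ 2 * (K : ℝ) ^ 2 * ‖u‖ ^ 2 ∂μ := by
      refine integral_mono_of_nonneg (ae_of_all _ (lowEnstrophy_nonneg K)) (h2.const_mul _)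
        (ae_of_all _ (lowEnstrophy_le K))
    rw [integral_const_mul] at hle
    have hE0 : ∫ u, ‖u‖ ^ 2 ∂μ ≤ E := hE
    calc ν * ∫ u, (Torus.eGradNormSq (Torus.fourierTruncate K ((u : L2T3) : T3 → R3))).toReal ∂μ
        ≤ ν * (4 * Real.pi ^ 2 * (K : ℝ) ^ 2 * ∫ u, ‖u‖ ^ 2 ∂μ) :=
          mul_le_mul_of_nonneg_left hle hν
      _ ≤ ν * (4 * Real.pi ^ 2 * (K : ℝ) ^ 2 * E) := by gcongr
      _ = 4 * Real.pi ^ 2 * (K : ℝ) ^ 2 * ν * E := by ring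
  rw [hid]
  linarith

/-- **NO FLUX-FREE WITNESS.** If `‖f − P_K f‖₂ √E + 4π²K²νE < ε` for some `K ≤ N`, every witness
has `∫ Π_K dμ > 0`: its cubic moment functional `Π_K` is charged (so e.g. no law all of whose odd
moments about `0` vanish, and no law whose third moments are those of its symmetrisation, can witness). -/
theorem IsWitness.integral_flux_pos {f : T3 → R3} (hfs : Torus.IsSmooth f) {ν : ℝ} (hν : 0 ≤ ν) {N : ℕ}
    {E ε : ℝ} {μ : Measure H3} (hW : IsWitness f ν N E ε μ) {K : ℕ} (hK : K ≤ N)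
    (hsmall : Real.sqrt (∫ x, ‖f x - Torus.fourierTruncate K f x‖ ^ 2) * Real.sqrt E +
      4 * Real.pi ^ 2 * (K : ℝ) ^ 2 * ν * E < ε) :
    0 < ∫ u, (-Torus.inertialPairing (u : L2T3) (Torus.fourierTruncate K ((u : L2T3) : T3 → R3))) ∂μ := by
  have h := hW.flux_floor hfs hν hK
  linarith

end FluxFloor


end Summit.AnomalousDissipation.AnomalousDissipation.Cruxes.CubicParityLoud.Disproof
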